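import Literature.NumberTheory.Sieve.MaynardSieveS2
import Literature.NumberTheory.Sieve.MaynardSieveLemma53
import Literature.NumberTheory.Sieve.MaynardSieveCounting
import Literature.NumberTheory.Sieve.CoprimeSquarefreeSumsBounds
import Literature.NumberTheory.Sieve.GoldstonGrahamPintzYildirim
import Literature.NumberTheory.LFunctions.MertensTail
import HarnessLib

/-!
# Maynard 2015, proof of Lemma 6.3: the evaluation of `y^{(m)}` (discharge of `maynard_lemma63_ym` from Lemma 6.1)

Topic `Literature/NumberTheory/Sieve`; continues `MaynardSieveS2.lean` (the named fact
`Literature.NumberTheory.Sieve.maynard_lemma63_ym`: for `r_m = 1`, `∏ rᵢ` squarefree and coprime to `W`,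
`y^{(m)}_r = (log R)(φ(W)/W)(∏ φ(rᵢ)/rᵢ) F^{(m)}_r + O(F_max φ(W) log R/(W D₀))`, uniformly in `r`),
`MaynardSieveLemma53.lean` (Maynard's Lemma 5.3 in finite form, `MaynardSieve.abs_ym_sub_main_le`)
and `GoldstonGrahamPintzYildirim.lean` (Maynard's Lemma 6.1 = Goldston–Graham–Pintz–Yıldırım 2009,
Lemma 4 with `κ = 1`, the named fact `GGPY.moebiusSqGSumWeighted_asymptotic`). J. Maynard, *Small gaps between primes*, Ann. of Math. (2)
181 (2015), 383–413 = arXiv:1311.4600; pages refer to the arXiv text.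

Main result: `Literature.maynard_lemma63_ym_of_GGPY (h4 : GGPY.moebiusSqGSumWeighted_asymptotic) : maynard_lemma63_ym` — the
evaluation of `y^{(m)}` (proof of Lemma 6.3, p. 14) PROVED from Lemma 6.1 alone, along the printed
argument:

* Lemma 5.3 (tree): `|y^{(m)}_r − κ(r) M(r)| ≤ y_max κ k L_φ (Z − 1) Z^k` with
  `M(r) = ∑_a y_{r[m↦a]}/φ(a)`, `κ(r) = ∏ g(rᵢ)rᵢ/φ(rᵢ)² ∈ [1 − k/(D₀−1), 1]`; here
  `L_φ = ∑_{u ≤ R good} 1/φ(u) ≪ (φ(W)/W) log R` and `Z = ∑_{u ≤ R good} 1/φ(u)² ≤ exp(1/(D₀−1))`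
  are the tree's explicit estimates of `CoprimeSquarefreeSumsBounds.lean`
  (`SquarefreeSums.abs_sum_inv_totient_sub_le`, `SquarefreeSums.sum_invSqAF_le_exp`; repackaged
  along `N` as `eventually_sum_inv_totient_le`, `sum_inv_totient_sq_le`), so this and
  `|κ M − M|` are `O(F_max φ(W) log R/(W D₀))`;
* the `u`-sum `M(r)` IS a weighted sum `∑_{d<z} μ(d)² g(d) F̃(log(z/d)/log z)` of the type of
  Lemma 6.1 (`Mterm_eq_moebiusSqGSumWeighted`): `γ = 1_{p ∤ W∏rᵢ}` (`gammaInd`; `g = 1/φ` on the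
  integers coprime to `W∏rᵢ`, `moebius_sq_mul_g_gammaInd`), `z = ⌊R^{1−s}⌋ + 1` with
  `s = ∑ log rᵢ/log R` (so that `d < z` is exactly the cut-off `1_{R_k}`), and
  `F̃(t) = G(x₁, …, (1−t)ℓ, …, x_k)`, `ℓ = log z/log R`, a `C¹` function with
  `sup_{[0,1]} (|F̃| + |F̃'|) ≤ sup |G| + 2 sup ‖∇G‖` over `[0,2]^k` (`contDiff_Ftilde`, `abs_deriv_Ftilde_le`);
* the hypotheses of Lemma 6.1 for this `γ`: `(Ω₁)` with `A₁ = 2` (`hypOmega1_gammaInd`) and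
  `(Ω₂(1, L))` with `A₂ = 10`, `L = 6 + ∑_{p ∣ W∏rᵢ} log p/p` (`hypOmega2_gammaInd`, from the tree's
  two-sided explicit Mertens I, `MertensTail`/`MertensElementary`), and Maynard's bound
  `L ≪ log log N` (`sum_primeFactors_log_div_le`: `∑_{p∣P} log p/p ≤ log T + log 4 + log P/T`,
  `T = log R`), whence `L · D₀ ≤ log R` eventually (`eventually_loglog_mul_maynardD0_le`);
* the singular series `c_γ = φ(W∏rᵢ)/(W∏rᵢ) = (φ(W)/W) ∏ φ(rᵢ)/rᵢ` (`cGamma_gammaInd`,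
  `totient_mul_prod_div`) and the main term: `c_γ log z ∫₀¹ F̃(1−t) dt = c_γ log R ∫₀^ℓ G`
  (`log_mul_integral_Ftilde`), `F^{(m)}_r = ∫₀^{1−s} G` (`maynardFm_eq_integral`), and
  `0 ≤ ℓ − (1 − s) ≤ log 2/log R`, so the two differ by `O(c_γ F_max)`.

The remaining named fact on this path is `GGPY.moebiusSqGSumWeighted_asymptotic` (= Halberstam–Richert,
*Sieve Methods*, Lemmas 5.3–5.4 with `κ = 1`, plus partial summation).

## References

* J. Maynard, *Small gaps between primes*, Ann. of Math. (2) 181 (2015), 383–413,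
  doi:10.4007/annals.2015.181.1.7, arXiv:1311.4600 [MaynardAnnals2015]: Lemma 5.3 (p. 11), Lemma
  6.1 (p. 13), proof of Lemma 6.3 (evaluation of `y^{(m)}`, the choice of `γ` and `L`, p. 14).
* D. A. Goldston, S. W. Graham, J. Pintz, C. Y. Yıldırım, *Small gaps between products of two
  primes*, Proc. Lond. Math. Soc. (3) 98 (2009), 741–774, Lemma 4 [GoldstonEtAl2008].
-/

noncomputable section

open Finset Filter Asymptotics MeasureTheory
open scoped BigOperators ArithmeticFunction.Moebius Topology

namespace Literature.NumberTheory.Sieve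

/-! ### One-dimensional bounds: `∑_{u ≤ R good} 1/φ(u) ≪ (φ(W)/W) log R` and `∑_{u ≤ R good} 1/φ(u)² ≤ 1 + O(1/D₀)`

Both are the tree's explicit two-sided estimates of `CoprimeSquarefreeSumsBounds.lean`
(`SquarefreeSums.abs_sum_inv_totient_sub_le`, `SquarefreeSums.sum_invSqAF_le_exp` with `a = 1`),
repackaged over `MaynardSieve.G1 W B = {u ≤ B : u squarefree, (u, W) = 1}` and along `N`. -/

/-- Eventually (in `N`) `∑_{u ≤ R good} 1/φ(u) ≤ (2 + B(2)) (φ(W)/W) log R`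
(`R = N^{θ/2−δ}`, `W = ∏_{p ≤ D₀} p`; the `O_W(1)` is absorbed since `W³ ≤ 64^{D₀} = o(log N)`).
[cite: MaynardAnnals2015, proof of Lemma 5.1 (the bound ∑_{u<R,(u,W)=1} μ(u)²/φ(u) ≪ φ(W) log R/W)] -/
theorem eventually_sum_inv_totient_le {θ δ : ℝ} (hη : 0 < θ / 2 - δ) :
    ∀ᶠ N : ℕ in atTop, ∑ u ∈ MaynardSieve.G1 (maynardW N) ⌊maynardR θ δ N⌋₊, 1 / (u.totient : ℝ) ≤
      (2 + SquarefreeSums.bConst 2) *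
        (((Nat.totient (maynardW N) : ℝ) / (maynardW N)) * Real.log (maynardR θ δ N)) := by
  set b := SquarefreeSums.bConst 2 with hb
  have hb1 : 1 ≤ b := SquarefreeSums.one_le_bConst (by norm_num)
  have hc : 0 < (θ / 2 - δ) / (11 * b) := by positivity
  have h64 := (isLittleO_pow_maynardD0_log (b := (64 : ℝ)) (by norm_num)).bound hc
  filter_upwards [h64, eventually_two_le_maynardD0, eventually_ge_atTop 2] with N h64N hD2 hN2
  have hN1 : 1 ≤ N := by omega
  have hW0 : maynardW N ≠ 0 := (primorial_pos _).ne'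
  have hWpos : (0 : ℝ) < maynardW N := by exact_mod_cast primorial_pos _
  have hφpos : (0 : ℝ) < Nat.totient (maynardW N) := by
    exact_mod_cast Nat.totient_pos.2 (primorial_pos _)
  have hD1 : 1 ≤ maynardD0 N := by omega
  have hDW : ∀ p, p.Prime → p ≤ maynardD0 N → p ∣ maynardW N :=
    fun p hp hle => dvd_maynardW_of_prime_le hp hle
  have hR1 : 1 ≤ maynardR θ δ N := by
    unfold maynardR
    exact Real.one_le_rpow (by exact_mod_cast hN1) hη.le
  have hlogR : Real.log (maynardR θ δ N) = (θ / 2 - δ) * Real.log N := log_maynardR hN1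
  have hlogN : 0 < Real.log N := Real.log_pos (by exact_mod_cast hN2)
  have hlogR0 : 0 ≤ Real.log (maynardR θ δ N) := by rw [hlogR]; positivity
  -- `L_φ` from the two-sided estimate of `CoprimeSquarefreeSumsBounds` at `B = ⌊R⌋₊`
  have hB1 : 1 ≤ ⌊maynardR θ δ N⌋₊ := Nat.le_floor (by simpa using hR1)
  have hlogB : Real.log (⌊maynardR θ δ N⌋₊ : ℕ) ≤ Real.log (maynardR θ δ N) :=
    Real.log_le_log (by exact_mod_cast hB1) (Nat.floor_le (by linarith))
  have hL : ∑ u ∈ MaynardSieve.G1 (maynardW N) ⌊maynardR θ δ N⌋₊, 1 / (u.totient : ℝ) ≤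
      (Nat.totient (maynardW N) : ℝ) / (maynardW N) * (1 + b * (maynardD0 N : ℝ) ^ (-(1 : ℝ) / 4)) *
          Real.log (maynardR θ δ N) + (SquarefreeSums.harmErr (maynardW N) + 4) * b := by
    have h := SquarefreeSums.abs_sum_inv_totient_sub_le hW0 hD1 hDW hB1
    rw [← hb] at h
    unfold MaynardSieve.G1
    have h' := (abs_sub_le_iff.1 h).1
    have hA : 0 ≤ (Nat.totient (maynardW N) : ℝ) / (maynardW N) := by positivity
    have hBD : 0 ≤ b * (maynardD0 N : ℝ) ^ (-(1 : ℝ) / 4) := by positivity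
    calc ∑ n ∈ (Finset.Icc 1 ⌊maynardR θ δ N⌋₊).filter (fun n => Squarefree n ∧ n.Coprime (maynardW N)),
          1 / (n.totient : ℝ)
        ≤ (Nat.totient (maynardW N) : ℝ) / (maynardW N) * Real.log (⌊maynardR θ δ N⌋₊ : ℕ) +
          ((SquarefreeSums.harmErr (maynardW N) + 4) * b +
            (Nat.totient (maynardW N) : ℝ) / (maynardW N) * (b * (maynardD0 N : ℝ) ^ (-(1 : ℝ) / 4)) *
              Real.log (⌊maynardR θ δ N⌋₊ : ℕ)) := by linarith
      _ ≤ (Nat.totient (maynardW N) : ℝ) / (maynardW N) * Real.log (maynardR θ δ N) +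
          ((SquarefreeSums.harmErr (maynardW N) + 4) * b +
            (Nat.totient (maynardW N) : ℝ) / (maynardW N) * (b * (maynardD0 N : ℝ) ^ (-(1 : ℝ) / 4)) *
              Real.log (maynardR θ δ N)) := by gcongr
      _ = _ := by ring
  have hD14 : (maynardD0 N : ℝ) ^ (-(1 : ℝ) / 4) ≤ 1 :=
    Real.rpow_le_one_of_one_le_of_nonpos (by exact_mod_cast hD1) (by norm_num)
  have hK : (SquarefreeSums.harmErr (maynardW N) + 4) * b ≤
      (Nat.totient (maynardW N) : ℝ) / (maynardW N) * Real.log (maynardR θ δ N) := by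
    have hK1 : (SquarefreeSums.harmErr (maynardW N) + 4) * b ≤ 11 * (maynardW N : ℝ) ^ 2 * b := by
      have := harmErr_add_four_le (W := maynardW N) (primorial_pos _)
      gcongr
    have hW4 : (maynardW N : ℝ) ≤ 4 ^ maynardD0 N := maynardW_le_four_pow N
    have h64' : (64 : ℝ) ^ maynardD0 N ≤ (θ / 2 - δ) / (11 * b) * Real.log N := by
      have := h64N
      rwa [Real.norm_of_nonneg (by positivity), Real.norm_of_nonneg hlogN.le] at this
    have hW2 : (maynardW N : ℝ) ^ 2 * (4 : ℝ) ^ maynardD0 N ≤ (64 : ℝ) ^ maynardD0 N := by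
      calc (maynardW N : ℝ) ^ 2 * (4 : ℝ) ^ maynardD0 N
          ≤ ((4 : ℝ) ^ maynardD0 N) ^ 2 * (4 : ℝ) ^ maynardD0 N := by gcongr
        _ = (64 : ℝ) ^ maynardD0 N := by
          rw [← pow_mul, ← pow_add, show maynardD0 N * 2 + maynardD0 N = 3 * maynardD0 N by ring,
            pow_mul]; norm_num
    have hlow : Real.log (maynardR θ δ N) / (4 : ℝ) ^ maynardD0 N ≤
        (Nat.totient (maynardW N) : ℝ) / (maynardW N) * Real.log (maynardR θ δ N) := by
      rw [div_le_iff₀ (by positivity)]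
      have hφ1 : (1 : ℝ) ≤ Nat.totient (maynardW N) := by
        exact_mod_cast Nat.totient_pos.2 (primorial_pos _)
      calc Real.log (maynardR θ δ N) = 1 / (maynardW N : ℝ) * Real.log (maynardR θ δ N) * maynardW N := by
            field_simp
        _ ≤ (Nat.totient (maynardW N) : ℝ) / (maynardW N) * Real.log (maynardR θ δ N) *
              (4 : ℝ) ^ maynardD0 N := by gcongr
    refine hK1.trans (le_trans ?_ hlow)
    rw [le_div_iff₀ (by positivity), hlogR]
    calc 11 * (maynardW N : ℝ) ^ 2 * b * (4 : ℝ) ^ maynardD0 N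
        = 11 * b * ((maynardW N : ℝ) ^ 2 * (4 : ℝ) ^ maynardD0 N) := by ring
      _ ≤ 11 * b * (64 : ℝ) ^ maynardD0 N := by gcongr
      _ ≤ 11 * b * ((θ / 2 - δ) / (11 * b) * Real.log N) := by gcongr
      _ = (θ / 2 - δ) * Real.log N := by field_simp
  calc ∑ u ∈ MaynardSieve.G1 (maynardW N) ⌊maynardR θ δ N⌋₊, 1 / (u.totient : ℝ)
      ≤ (Nat.totient (maynardW N) : ℝ) / (maynardW N) * (1 + b * (maynardD0 N : ℝ) ^ (-(1 : ℝ) / 4)) *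
          Real.log (maynardR θ δ N) + (SquarefreeSums.harmErr (maynardW N) + 4) * b := hL
    _ ≤ (Nat.totient (maynardW N) : ℝ) / (maynardW N) * (1 + b * 1) * Real.log (maynardR θ δ N) +
          (Nat.totient (maynardW N) : ℝ) / (maynardW N) * Real.log (maynardR θ δ N) := by
        gcongr
    _ = (2 + b) * ((Nat.totient (maynardW N) : ℝ) / (maynardW N) * Real.log (maynardR θ δ N)) := by
        ring

/-- **`Z = ∑_{u ≤ B good} 1/φ(u)² ≤ exp(1/(D₀ − 1))`** when every prime `≤ D₀` divides `W` (`D₀ ≥ 2`)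
(Maynard: "`Z − 1 ≪ 1/D₀` since good `s > 1` exceed `D₀`", the bound behind (5.14) and (5.30)); a
repackaging of `SquarefreeSums.sum_invSqAF_le_exp` (`a = 1`) over `MaynardSieve.G1`.
[cite: MaynardAnnals2015, proof of Lemma 5.1 (the contribution from s_{i,j} > D₀)] -/
theorem sum_inv_totient_sq_le {W B D₀ : ℕ} (hD : 2 ≤ D₀) (hDW : ∀ p, p.Prime → p ≤ D₀ → p ∣ W) :
    ∑ u ∈ MaynardSieve.G1 W B, 1 / (u.totient : ℝ) ^ 2 ≤ Real.exp (1 / ((D₀ : ℝ) - 1)) := by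
  have h := SquarefreeSums.sum_invSqAF_le_exp (W := W) (a := 1) (D₀ := D₀) (by omega) hDW B
  have hsum : ∑ n ∈ Finset.Icc 1 B, SquarefreeSums.invSqAF W 1 n =
      ∑ u ∈ MaynardSieve.G1 W B, 1 / (u.totient : ℝ) ^ 2 := by
    unfold MaynardSieve.G1
    rw [Finset.sum_filter]
    refine Finset.sum_congr rfl fun n hn => ?_
    have hn0 : n ≠ 0 := by have := (Finset.mem_Icc.1 hn).1; omega
    split_ifs with h'
    · exact SquarefreeSums.invSqAF_one_eq hn0 h'.1 h'.2
    · rw [SquarefreeSums.invSqAF_apply, if_neg (fun h'' => h' h''.2)]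
  rw [hsum] at h
  simpa using h


/-! ### Maynard's `γ` for the evaluation of `y^{(m)}` and the hypotheses of Lemma 6.1 -/

/-- Maynard's `γ(p) = 1` if `p ∤ P`, `0` otherwise (proof of Lemma 6.3, choice of `γ` for the
`u`-sum, with `P = W ∏ rᵢ`). [cite: MaynardAnnals2015, proof of Lemma 6.3 (choice of γ, p. 14)] -/
def gammaInd (P : ℕ) (p : ℕ) : ℝ := if p ∣ P then 0 else 1

/-- `γ` takes values in `{0, 1}`. [folklore] -/
theorem gammaInd_mem (P p : ℕ) : gammaInd P p = 0 ∨ gammaInd P p = 1 := by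
  unfold gammaInd; split_ifs <;> simp

/-- `(Ω₁)` with `A₁ = 2`: `0 ≤ γ(p)/p ≤ 1/2`. [cite: MaynardAnnals2015, proof of Lemma 6.3 ("A₁, A₂ suitable fixed constants")] -/
theorem hypOmega1_gammaInd (P : ℕ) : GGPY.HypOmega1 (gammaInd P) 2 := by
  intro p hp
  have h2 : (2 : ℝ) ≤ p := by exact_mod_cast hp.two_le
  rcases gammaInd_mem P p with h | h <;> rw [h]
  · norm_num
  · rw [one_div, one_div, ← one_div]
    constructor
    · positivity
    · rw [div_le_iff₀ (by linarith)]; linarith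

/-- `∑_{p prime, a ≤ p < b} log p/p = S(b−1) − S(a−1)`, `S(n) = ∑_{p ≤ n} log p/p` (`a ≥ 1`). [folklore] -/
theorem sum_Ico_filter_prime_eq_sub {a b : ℕ} (ha : 1 ≤ a) (hab : a ≤ b) (f : ℕ → ℝ) :
    ∑ p ∈ (Finset.Ico a b).filter Nat.Prime, f p =
      ∑ p ∈ Nat.primesLE (b - 1), f p - ∑ p ∈ Nat.primesLE (a - 1), f p := by
  have hsub : Nat.primesLE (a - 1) ⊆ Nat.primesLE (b - 1) := Nat.primesLE_mono (by omega)
  rw [eq_sub_iff_add_eq, ← Finset.sum_sdiff hsub]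
  congr 1
  apply Finset.sum_congr ?_ (fun _ _ => rfl)
  ext p
  simp only [Finset.mem_sdiff, Nat.mem_primesLE, Finset.mem_filter, Finset.mem_Ico]
  constructor
  · rintro ⟨⟨h1, h2⟩, hp⟩
    have := hp.two_le
    exact ⟨⟨by omega, hp⟩, fun h => by omega⟩
  · rintro ⟨⟨h1, hp⟩, h2⟩
    have := hp.two_le
    refine ⟨⟨?_, by omega⟩, hp⟩
    by_contra hlt
    exact h2 ⟨by omega, hp⟩

/-- **`(Ω₂)` for Maynard's `γ`**, with `κ = 1`, `A₂ = 10` and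
`L = 6 + ∑_{p ∣ P} log p/p` (Maynard: "`L ≪ 1 + ∑_{p ∣ W∏rᵢ} log p/p`"), for `P ≥ 1`: from the tree's
explicit two-sided Mertens I, `log n − 3 ≤ ∑_{p ≤ n} log p/p ≤ log n + log 4`.
[cite: MaynardAnnals2015, proof of Lemma 6.3 (the bound L ≪ 1 + ∑_{p∣W∏r_i} log p/p)] -/
theorem hypOmega2_gammaInd {P : ℕ} (hP : P ≠ 0) :
    GGPY.HypOmega2 (gammaInd P) 1 10 (6 + ∑ p ∈ P.primeFactors, Real.log p / p) := by
  intro w z hw hwz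
  set a := ⌈w⌉₊ with ha
  set b := ⌈z⌉₊ with hb
  have hw0 : 0 < w := by linarith
  have hz0 : 0 < z := by linarith
  have hz2 : 2 ≤ z := hw.trans hwz
  have haw : w ≤ (a : ℝ) := Nat.le_ceil w
  have hbz : z ≤ (b : ℝ) := Nat.le_ceil z
  have haw' : (a : ℝ) < w + 1 := Nat.ceil_lt_add_one hw0.le
  have hbz' : (b : ℝ) < z + 1 := Nat.ceil_lt_add_one hz0.le
  have ha2 : 2 ≤ a := by
    have : (2 : ℝ) ≤ a := hw.trans haw
    exact_mod_cast this
  have hab : a ≤ b := Nat.ceil_mono hwz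
  have hb2 : 2 ≤ b := ha2.trans hab
  -- the full prime sum `T = S(b-1) - S(a-1)` and its bounds
  set T := ∑ p ∈ (Finset.Ico a b).filter Nat.Prime, Real.log p / p with hT
  have hTeq : T = ∑ p ∈ Nat.primesLE (b - 1), Real.log p / p -
      ∑ p ∈ Nat.primesLE (a - 1), Real.log p / p :=
    sum_Ico_filter_prime_eq_sub (by omega) hab _
  have hSb_lo := LFunctions.MertensBound.log_sub_three_le_sum_log_div_prime (b - 1)
  have hSb_hi := LFunctions.MertensBound.sum_log_div_prime_le (b - 1)
  have hSa_lo := LFunctions.MertensBound.log_sub_three_le_sum_log_div_prime (a - 1)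
  have hSa_hi := LFunctions.MertensBound.sum_log_div_prime_le (a - 1)
  have hcastb : ((b - 1 : ℕ) : ℝ) = (b : ℝ) - 1 := by rw [Nat.cast_sub (by omega), Nat.cast_one]
  have hcasta : ((a - 1 : ℕ) : ℝ) = (a : ℝ) - 1 := by rw [Nat.cast_sub (by omega), Nat.cast_one]
  rw [hcastb] at hSb_lo hSb_hi
  rw [hcasta] at hSa_lo hSa_hi
  have hlog2 := Real.log_two_lt_d9
  have hlog2pos : 0 < Real.log 2 := Real.log_pos one_lt_two
  have hlog4 : Real.log 4 = 2 * Real.log 2 := by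
    rw [show (4 : ℝ) = 2 ^ 2 by norm_num, Real.log_pow]; norm_num
  -- compare `log(b-1)` with `log z`, `log(a-1)` with `log w`
  have hb1pos : (0 : ℝ) < (b : ℝ) - 1 := by
    have : (2 : ℝ) ≤ b := by exact_mod_cast hb2
    linarith
  have ha1pos : (0 : ℝ) < (a : ℝ) - 1 := by
    have : (2 : ℝ) ≤ a := by exact_mod_cast ha2
    linarith
  have hlogb_hi : Real.log ((b : ℝ) - 1) ≤ Real.log z := Real.log_le_log hb1pos (by linarith)
  have hlogb_lo : Real.log z - Real.log 2 ≤ Real.log ((b : ℝ) - 1) := by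
    rw [← Real.log_div hz0.ne' two_ne_zero]
    exact Real.log_le_log (by positivity) (by linarith)
  have hloga_hi : Real.log ((a : ℝ) - 1) ≤ Real.log w := Real.log_le_log ha1pos (by linarith)
  have hloga_lo : Real.log w - Real.log 2 ≤ Real.log ((a : ℝ) - 1) := by
    rw [← Real.log_div hw0.ne' two_ne_zero]
    exact Real.log_le_log (by positivity) (by linarith)
  have hlogzw : Real.log (z / w) = Real.log z - Real.log w := Real.log_div hz0.ne' hw0.ne'
  -- the removed part `D`
  set D := ∑ p ∈ (Finset.Ico a b).filter Nat.Prime, (if p ∣ P then Real.log p / p else 0) with hD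
  have hD0 : 0 ≤ D := Finset.sum_nonneg fun p hp => by
    split_ifs
    · have := (Finset.mem_filter.1 hp).2; positivity
    · exact le_rfl
  have hDle : D ≤ ∑ p ∈ P.primeFactors, Real.log p / p := by
    rw [hD, ← Finset.sum_filter]
    refine Finset.sum_le_sum_of_subset_of_nonneg (fun p hp => ?_) fun p hp _ => by
      have := (Nat.prime_of_mem_primeFactors hp).pos; positivity
    rw [Finset.mem_filter, Finset.mem_filter] at hp
    exact Nat.mem_primeFactors.2 ⟨hp.1.2, hp.2, hP⟩
  -- `omega2Sum = T - D`
  have hsum : GGPY.omega2Sum (gammaInd P) w z = T - D := by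
    unfold GGPY.omega2Sum
    rw [hT, hD, ← Finset.sum_sub_distrib]
    refine Finset.sum_congr rfl fun p _ => ?_
    unfold gammaInd
    split_ifs <;> ring
  rw [hsum, hlogzw]
  constructor
  · -- lower bound
    have : Real.log z - Real.log w - 6 ≤ T := by rw [hTeq]; linarith
    linarith
  · -- upper bound
    have : T ≤ Real.log z - Real.log w + 6 := by rw [hTeq]; linarith
    linarith


/-! ### The `u`-sum of Lemma 5.3 as a weighted sum of Goldston–Graham–Pintz–Yıldırım type -/

/-- For `d ≥ 1`: `μ(d)² g(d) = 1_{(d,P)=1} μ(d)²/φ(d)` for `g` built from Maynard's `γ = 1_{p ∤ P}`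
(`g(p) = γ(p)/(p − γ(p)) = 1/(p−1)` or `0`). [cite: MaynardAnnals2015, proof of Lemma 6.3 (choice of γ, p. 14)] -/
theorem moebius_sq_mul_g_gammaInd {P d : ℕ} (hd : d ≠ 0) :
    ((μ d : ℤ) : ℝ) ^ 2 * GGPY.g (gammaInd P) d =
      if Squarefree d ∧ d.Coprime P then 1 / (d.totient : ℝ) else 0 := by
  by_cases hsq : Squarefree d
  · have hμ : ((μ d : ℤ) : ℝ) ^ 2 = 1 := by
      have h1 := ArithmeticFunction.abs_moebius_eq_one_of_squarefree hsq
      rw [← sq_abs, ← Int.cast_abs, h1]; simp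
    rw [hμ, one_mul]
    unfold GGPY.g
    by_cases hco : d.Coprime P
    · rw [if_pos ⟨hsq, hco⟩]
      have hφ : (d.totient : ℝ) = ∏ p ∈ d.primeFactors, ((p : ℝ) - 1) := by
        have h := MaynardSieve.isMultiplicative_totAF.prod_primeFactors hsq
        rw [MaynardSieve.totAF_apply] at h
        rw [← h]
        refine Finset.prod_congr rfl fun p hp => ?_
        have hpp := Nat.prime_of_mem_primeFactors hp
        rw [MaynardSieve.totAF_apply, Nat.totient_prime hpp, Nat.cast_sub hpp.one_lt.le, Nat.cast_one]
      rw [hφ, one_div, ← Finset.prod_inv_distrib]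
      refine Finset.prod_congr rfl fun p hp => ?_
      have hpp := Nat.prime_of_mem_primeFactors hp
      have hpd := Nat.dvd_of_mem_primeFactors hp
      have hpP : ¬p ∣ P := fun h =>
        hpp.ne_one ((Nat.Coprime.coprime_dvd_left hpd hco).eq_one_of_dvd h)
      unfold gammaInd
      rw [if_neg hpP, one_div]
    · rw [if_neg (fun h => hco h.2)]
      have hg : Nat.gcd d P ≠ 1 := hco
      have hg0 : Nat.gcd d P ≠ 0 := (Nat.gcd_pos_of_pos_left P (Nat.pos_of_ne_zero hd)).ne'
      set q := (Nat.gcd d P).minFac with hq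
      have hqp : q.Prime := Nat.minFac_prime hg
      have hqd : q ∣ d := (Nat.minFac_dvd _).trans (Nat.gcd_dvd_left d P)
      have hqP : q ∣ P := (Nat.minFac_dvd _).trans (Nat.gcd_dvd_right d P)
      refine Finset.prod_eq_zero (i := q) (Nat.mem_primeFactors.2 ⟨hqp, hqd, hd⟩) ?_
      unfold gammaInd
      rw [if_pos hqP, zero_div]
  · rw [ArithmeticFunction.moebius_eq_zero_of_not_squarefree hsq, if_neg (fun h => hsq h.1)]
    simp

/-- Membership of `x` with its `m`-th coordinate replaced by `v ≥ 0` in the simplex `R_k`, when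
`x ≥ 0` and `x_m = 0`: `∑ xᵢ + v ≤ 1`. [folklore] -/
theorem update_mem_maynardSimplex_iff {k : ℕ} {x : Fin k → ℝ} (hx : ∀ i, 0 ≤ x i) {m : Fin k}
    (hxm : x m = 0) {v : ℝ} (hv : 0 ≤ v) :
    Function.update x m v ∈ maynardSimplex k ↔ (∑ i, x i) + v ≤ 1 := by
  classical
  unfold maynardSimplex
  simp only [Set.mem_setOf_eq]
  have hsum : ∑ i, Function.update x m v i = v + ∑ i ∈ Finset.univ \ {m}, x i :=
    Finset.sum_update_of_mem (Finset.mem_univ m) x v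
  have hsum' : ∑ i, x i = x m + ∑ i ∈ Finset.univ \ {m}, x i :=
    Finset.sum_eq_add_sum_sdiff_singleton_of_mem (Finset.mem_univ m) x
  constructor
  · rintro ⟨-, h⟩
    rw [hsum] at h
    rw [hsum', hxm]
    linarith
  · intro h
    refine ⟨fun i => ?_, ?_⟩
    · by_cases hi : i = m
      · subst hi; simpa using hv
      · rw [Function.update_of_ne hi]; exact hx i
    · rw [hsum]
      rw [hsum', hxm] at h
      linarith

/-- **`y` at the tuples `u[m ↦ a]`** (`u` good with `u_m = 1`, `1 ≤ a ≤ ⌊R⌋`):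
`y_{u[m↦a]} = 1[a squarefree, (a, W ∏ uᵢ) = 1] · F(x₁, …, log a/log R, …, x_k)`, `xᵢ = log uᵢ/log R`,
`F = G · 1_{R_k}` (Maynard: "we may restrict the summation over `a_j` to `(a_j, W) = 1`" and the
support of `y`). [cite: MaynardAnnals2015, proofs of Lemma 5.3 and Lemma 6.3 (the sum over u with (u, W∏r_i) = 1)] -/
theorem maynardY_update_eq {k : ℕ} (G : (Fin k → ℝ) → ℝ) (R : ℝ) (W : ℕ) {m : Fin k}
    {u : Fin k → ℕ} (hu : u ∈ MaynardSieve.boxG k W ⌊R⌋₊) (hum : u m = 1) {a : ℕ}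
    (ha : a ∈ Finset.Icc 1 ⌊R⌋₊) :
    maynardY k ((maynardSimplex k).indicator G) R W (Function.update u m a) =
      if Squarefree a ∧ a.Coprime (W * ∏ i, u i) then
        (maynardSimplex k).indicator G
          (Function.update (fun i => Real.log (u i) / Real.log R) m (Real.log a / Real.log R))
      else 0 := by
  classical
  have hgood := (MaynardSieve.mem_boxG.1 hu).2
  have hbox : Function.update u m a ∈ maynardBox k R := by
    rw [mem_maynardBox_iff]
    intro i
    by_cases hi : i = m
    · subst hi; rw [Function.update_self]; exact Finset.mem_Icc.1 ha
    · rw [Function.update_of_ne hi]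
      exact MaynardSieve.mem_box.1 (MaynardSieve.mem_boxG.1 hu).1 i
  rw [maynardY_eq _ R W hbox]
  have hpt : (fun i => Real.log ((Function.update u m a i : ℕ) : ℝ) / Real.log R) =
      Function.update (fun i => Real.log (u i) / Real.log R) m (Real.log a / Real.log R) := by
    funext i
    by_cases hi : i = m
    · subst hi; simp
    · simp [Function.update_of_ne hi]
  have hprod' : ∏ i, u i = ∏ i ∈ Finset.univ \ {m}, u i := by
    rw [Finset.prod_eq_mul_prod_sdiff_singleton_of_mem (Finset.mem_univ m) u, hum, one_mul]
  have hprod : ∏ i, Function.update u m a i = a * ∏ i, u i := by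
    rw [Finset.prod_update_of_mem (Finset.mem_univ m), hprod']
  have hcopW : (∀ i, Nat.Coprime (Function.update u m a i) W) ↔ a.Coprime W := by
    constructor
    · intro h; have := h m; rwa [Function.update_self] at this
    · intro h i
      by_cases hi : i = m
      · subst hi; rwa [Function.update_self]
      · rw [Function.update_of_ne hi]; exact hgood.coprime_apply i
  rw [Set.indicator_indicator, Set.inter_self, hpt, hprod]
  by_cases hcond : Squarefree a ∧ a.Coprime (W * ∏ i, u i)
  · obtain ⟨hsqa, hco⟩ := hcond
    have hcoW : a.Coprime W := Nat.Coprime.coprime_mul_right_right hco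
    have hcoU : a.Coprime (∏ i, u i) := Nat.Coprime.coprime_mul_left_right hco
    rw [if_pos (hcopW.2 hcoW), if_pos ⟨hsqa, hco⟩]
    have hsq : Squarefree (a * ∏ i, u i) := Nat.squarefree_mul_iff.2 ⟨hcoU, hsqa, hgood.squarefree⟩
    have hμ : ((μ (a * ∏ i, u i) : ℤ) : ℝ) ^ 2 = 1 := by
      have h1 := ArithmeticFunction.abs_moebius_eq_one_of_squarefree hsq
      rw [← sq_abs, ← Int.cast_abs, h1]; simp
    rw [hμ, one_mul]
  · rw [if_neg hcond]
    split_ifs with hall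
    · -- then `μ(a ∏ uᵢ) = 0`
      have hcoW : a.Coprime W := hcopW.1 hall
      have hnsq : ¬Squarefree (a * ∏ i, u i) := by
        intro hsq
        rw [Nat.squarefree_mul_iff] at hsq
        exact hcond ⟨hsq.2.1, Nat.Coprime.mul_right hcoW hsq.1⟩
      rw [ArithmeticFunction.moebius_eq_zero_of_not_squarefree hnsq]
      simp
    · rfl

/-- **The `u`-sum of Lemma 5.3 is a weighted sum of the type of Lemma 6.1** (Maynard 2015, proof
of Lemma 6.3, the display `y^{(m)}_r = ∑_{(u, W∏rᵢ)=1} μ(u)²/φ(u) F(…, log u/log R, …) + O(…)`, p. 14):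
for `u` good with `u_m = 1` and `s = ∑ᵢ log uᵢ/log R ≤ 1`, with `z = ⌊R^{1−s}⌋ + 1` (so that
`a < z ↔ s + log a/log R ≤ 1`, the simplex condition) and `ℓ = log z/log R`,
`∑_{1 ≤ a ≤ ⌊R⌋} y_{u[m↦a]}/φ(a) = ∑_{d<z} μ(d)² g(d) F̃(log(z/d)/log z)`, `g` from `γ = 1_{p ∤ W∏uᵢ}`,
`F̃(t) = G(x₁, …, (1 − t) ℓ, …, x_k)`. [cite: MaynardAnnals2015, proof of Lemma 6.3 (the sum over u, p. 14)] -/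
theorem Mterm_eq_moebiusSqGSumWeighted {k : ℕ} (G : (Fin k → ℝ) → ℝ) {R : ℝ} (hR : 1 < R) (W : ℕ)
    {m : Fin k} {u : Fin k → ℕ} (hu : u ∈ MaynardSieve.boxG k W ⌊R⌋₊) (hum : u m = 1)
    (x : Fin k → ℝ) (hx : x = fun i => Real.log (u i) / Real.log R) (s : ℝ) (hsx : s = ∑ i, x i)
    (hs1 : s ≤ 1) (z : ℕ) (hz : z = ⌊R ^ (1 - s)⌋₊ + 1) (ℓ : ℝ) (hℓ : ℓ = Real.log z / Real.log R) :
    MaynardSieve.Mterm ⌊R⌋₊ (maynardY k ((maynardSimplex k).indicator G) R W) m u =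
      GGPY.moebiusSqGSumWeighted (gammaInd (W * ∏ i, u i))
        (fun t => G (Function.update x m ((1 - t) * ℓ))) z := by
  classical
  have hlogR : 0 < Real.log R := Real.log_pos hR
  have hR0 : 0 < R := by linarith
  have hubox := MaynardSieve.mem_box.1 (MaynardSieve.mem_boxG.1 hu).1
  -- nonnegativity of the coordinates, `x_m = 0`, `s ≥ 0`
  have hx0 : ∀ i, 0 ≤ x i := fun i => by
    rw [hx]; exact div_nonneg (Real.log_natCast_nonneg _) hlogR.le
  have hxm : x m = 0 := by rw [hx]; simp [hum]
  have hs0 : 0 ≤ s := by rw [hsx]; exact Finset.sum_nonneg fun i _ => hx0 i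
  -- `z ≥ 2`, `log z > 0`
  have hRs : 1 ≤ R ^ (1 - s) := Real.one_le_rpow hR.le (by linarith)
  have hz2 : 2 ≤ z := by
    rw [hz]
    have : 1 ≤ ⌊R ^ (1 - s)⌋₊ := Nat.le_floor (by exact_mod_cast hRs)
    omega
  have hlogz : 0 < Real.log z := Real.log_pos (by exact_mod_cast (show 1 < z by omega))
  -- `z - 1 ≤ ⌊R⌋`
  have hzR : z - 1 ≤ ⌊R⌋₊ := by
    rw [hz, Nat.add_sub_cancel]
    refine Nat.floor_le_floor ?_
    calc R ^ (1 - s) ≤ R ^ (1 : ℝ) := Real.rpow_le_rpow_of_exponent_le hR.le (by linarith)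
      _ = R := Real.rpow_one R
  -- the simplex condition: for `1 ≤ a`, `s + log a/log R ≤ 1 ↔ a < z`
  have hcut : ∀ a : ℕ, 1 ≤ a → ((∑ i, x i) + Real.log a / Real.log R ≤ 1 ↔ a < z) := by
    intro a ha
    have ha0 : (0 : ℝ) < a := by exact_mod_cast ha
    rw [← hsx, hz, Nat.lt_succ_iff, Nat.le_floor_iff (by positivity)]
    rw [← Real.log_le_log_iff ha0 (by positivity), Real.log_rpow hR0]
    constructor
    · intro h
      have : Real.log a / Real.log R ≤ 1 - s := by linarith
      rwa [div_le_iff₀ hlogR] at this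
    · intro h
      have : Real.log a / Real.log R ≤ 1 - s := by rwa [div_le_iff₀ hlogR]
      linarith
  -- rewrite the left-hand side
  unfold MaynardSieve.Mterm
  have hL : ∀ a ∈ Finset.Icc 1 ⌊R⌋₊,
      maynardY k ((maynardSimplex k).indicator G) R W (Function.update u m a) / (a.totient : ℝ) =
        if a < z then
          (if Squarefree a ∧ a.Coprime (W * ∏ i, u i) then
            G (Function.update x m (Real.log a / Real.log R)) / (a.totient : ℝ) else 0)
        else 0 := by
    intro a ha
    have ha1 : 1 ≤ a := (Finset.mem_Icc.1 ha).1
    rw [maynardY_update_eq G R W hu hum ha, ← hx]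
    by_cases hcond : Squarefree a ∧ a.Coprime (W * ∏ i, u i)
    · rw [if_pos hcond]
      have hv : 0 ≤ Real.log a / Real.log R := div_nonneg (Real.log_natCast_nonneg _) hlogR.le
      by_cases haz : a < z
      · rw [if_pos haz, if_pos hcond, Set.indicator_of_mem]
        exact (update_mem_maynardSimplex_iff hx0 hxm hv).2 ((hcut a ha1).2 haz)
      · rw [if_neg haz, Set.indicator_of_notMem, zero_div]
        exact fun hmem => haz ((hcut a ha1).1 ((update_mem_maynardSimplex_iff hx0 hxm hv).1 hmem))
    · rw [if_neg hcond, zero_div]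
      split_ifs <;> rfl
  rw [Finset.sum_congr rfl hL, ← Finset.sum_filter]
  have hset : (Finset.Icc 1 ⌊R⌋₊).filter (fun a => a < z) = Finset.Ico 1 z := by
    ext a
    simp only [Finset.mem_filter, Finset.mem_Icc, Finset.mem_Ico]
    omega
  rw [hset]
  -- the right-hand side
  unfold GGPY.moebiusSqGSumWeighted
  rw [Nat.ceil_natCast]
  refine Finset.sum_congr rfl fun d hd => ?_
  have hd1 : 1 ≤ d := (Finset.mem_Ico.1 hd).1
  have hdz : d < z := (Finset.mem_Ico.1 hd).2
  have hd0 : (0 : ℝ) < d := by exact_mod_cast hd1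
  rw [moebius_sq_mul_g_gammaInd (by omega : d ≠ 0)]
  dsimp only
  -- the argument of `F̃`
  have harg : (1 - Real.log ((z : ℝ) / d) / Real.log z) * ℓ = Real.log d / Real.log R := by
    rw [Real.log_div (by positivity) hd0.ne', hℓ]
    field_simp
    ring
  rw [harg]
  split_ifs with hcond
  · rw [one_div, inv_mul_eq_div]
  · rw [zero_mul]


/-! ### The singular series and the constant `L` for Maynard's `γ` -/

/-- `c_γ = φ(P)/P` for `γ = 1_{p ∤ P}` (`κ = 1`, `P ≥ 1`). [cite: MaynardAnnals2015, proof of Lemma 6.3 (the factor φ(W)/W ∏ φ(r_i)/r_i)] -/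
theorem cGamma_gammaInd {P : ℕ} (hP : P ≠ 0) :
    GGPY.cGamma (gammaInd P) = (P.totient : ℝ) / P := by
  have hγ : gammaInd P = fun p => if p ∣ P then (0 : ℝ) else 1 := rfl
  have h := (GGPY.cGamma_indicator hP).2
  have hP0 : (0 : ℝ) < P := by exact_mod_cast Nat.pos_of_ne_zero hP
  rw [LFunctions.MertensBound.totient_eq_mul_prod_one_sub_inv P, mul_div_cancel_left₀ _ hP0.ne', hγ]
  exact h

/-- `φ(W ∏ uᵢ)/(W ∏ uᵢ) = (φ(W)/W) ∏ φ(uᵢ)/uᵢ` for a good tuple `u` (`∏ uᵢ` squarefree and coprime to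
`W`). [cite: MaynardAnnals2015, proof of Lemma 6.3 (the factor φ(W)/W ∏ φ(r_i)/r_i)] -/
theorem totient_mul_prod_div {k W : ℕ} (hW : W ≠ 0) {u : Fin k → ℕ} (hu : MaynardSieve.IsGood W u) :
    ((W * ∏ i, u i).totient : ℝ) / ((W * ∏ i, u i : ℕ) : ℝ) =
      (W.totient : ℝ) / W * ∏ i, ((u i).totient : ℝ) / (u i) := by
  have hcop : W.Coprime (∏ i, u i) := hu.coprime.symm
  rw [Nat.totient_mul hcop]
  have hprod : ((∏ i, u i).totient : ℝ) = ∏ i, ((u i).totient : ℝ) := by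
    have h := MaynardSieve.isMultiplicative_totAF.map_prod u Finset.univ (fun i _ j _ hij =>
      hu.coprime_of_ne hij)
    simp only [MaynardSieve.totAF_apply] at h
    rw [h]
  push_cast
  rw [hprod, Finset.prod_div_distrib]
  have hW0 : (W : ℝ) ≠ 0 := by exact_mod_cast hW
  have hU0 : ∀ i, (u i : ℝ) ≠ 0 := fun i => by exact_mod_cast hu.ne_zero i
  have hP0 : (∏ i, (u i : ℝ)) ≠ 0 := Finset.prod_ne_zero_iff.2 fun i _ => hU0 i
  field_simp

/-- **Maynard's bound for `L`**: for `P ≥ 1` and real `T ≥ 3`,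
`∑_{p ∣ P} log p/p ≤ log T + log 4 + log P/T` (the primes `≤ T` contribute at most `∑_{p ≤ T} log p/p`,
the at most `log P/log T` primes `> T` at most `log T/T` each; Maynard takes `T = log R`:
"`L ≪ ∑_{p<log R} log p/p + ∑_{p ∣ W∏rᵢ, p>log R} log log R/log R ≪ log log N`").
[cite: MaynardAnnals2015, proof of Lemma 6.3 (the bound L ≪ log log N, p. 14)] -/
theorem sum_primeFactors_log_div_le {P : ℕ} (hP : P ≠ 0) {T : ℝ} (hT : 3 ≤ T) :
    ∑ p ∈ P.primeFactors, Real.log p / p ≤ Real.log T + Real.log 4 + Real.log P / T := by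
  have hT0 : 0 < T := by linarith
  have hlogT : 0 < Real.log T := Real.log_pos (by linarith)
  have he : Real.exp 1 ≤ T := le_trans Real.exp_one_lt_d9.le (by linarith)
  rw [← Finset.sum_filter_add_sum_filter_not P.primeFactors (fun p : ℕ => (p : ℝ) ≤ T)]
  -- small primes
  have hsmall : ∑ p ∈ P.primeFactors.filter (fun p : ℕ => (p : ℝ) ≤ T), Real.log p / p ≤
      Real.log T + Real.log 4 := by
    calc ∑ p ∈ P.primeFactors.filter (fun p : ℕ => (p : ℝ) ≤ T), Real.log p / p
        ≤ ∑ p ∈ Nat.primesLE ⌊T⌋₊, Real.log p / p := by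
          refine Finset.sum_le_sum_of_subset_of_nonneg (fun p hp => ?_) fun p hp _ => by
            have := (Nat.mem_primesLE.1 hp).2.pos; positivity
          rw [Finset.mem_filter] at hp
          exact Nat.mem_primesLE.2 ⟨Nat.le_floor hp.2, Nat.prime_of_mem_primeFactors hp.1⟩
      _ ≤ Real.log (⌊T⌋₊ : ℕ) + Real.log 4 := LFunctions.MertensBound.sum_log_div_prime_le _
      _ ≤ Real.log T + Real.log 4 := by
          gcongr
          · exact_mod_cast Nat.floor_pos.2 (by linarith)
          · exact Nat.floor_le hT0.le
  -- large primes
  set S := P.primeFactors.filter (fun p : ℕ => ¬(p : ℝ) ≤ T) with hS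
  have hlarge1 : ∑ p ∈ S, Real.log p / p ≤ S.card * (Real.log T / T) := by
    rw [← nsmul_eq_mul, ← Finset.sum_const]
    refine Finset.sum_le_sum fun p hp => ?_
    rw [hS, Finset.mem_filter, not_le] at hp
    exact Real.log_div_self_antitoneOn he (le_trans he hp.2.le) hp.2.le
  have hcard : (S.card : ℝ) * Real.log T ≤ Real.log P := by
    calc (S.card : ℝ) * Real.log T = ∑ p ∈ S, Real.log T := by rw [Finset.sum_const, nsmul_eq_mul]
      _ ≤ ∑ p ∈ S, Real.log p := Finset.sum_le_sum fun p hp => by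
          rw [hS, Finset.mem_filter, not_le] at hp
          exact Real.log_le_log hT0 hp.2.le
      _ = Real.log (∏ p ∈ S, (p : ℝ)) := by
          rw [Real.log_prod]; intro p hp
          rw [hS, Finset.mem_filter] at hp
          exact_mod_cast (Nat.prime_of_mem_primeFactors hp.1).ne_zero
      _ ≤ Real.log P := by
          refine Real.log_le_log (Finset.prod_pos fun p hp => ?_) ?_
          · rw [hS, Finset.mem_filter] at hp
            exact_mod_cast (Nat.prime_of_mem_primeFactors hp.1).pos
          · have hdvd : ∏ p ∈ S, p ∣ P :=
              (Finset.prod_dvd_prod_of_subset _ _ _ (Finset.filter_subset _ _)).trans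
                (Nat.prod_primeFactors_dvd P)
            have hle : ∏ p ∈ S, p ≤ P := Nat.le_of_dvd (Nat.pos_of_ne_zero hP) hdvd
            rw [← Nat.cast_prod]
            exact_mod_cast hle
  have hlarge : ∑ p ∈ S, Real.log p / p ≤ Real.log P / T := by
    refine hlarge1.trans ?_
    rw [show (S.card : ℝ) * (Real.log T / T) = S.card * Real.log T / T by ring]
    gcongr
  linarith


/-! ### The test function `F̃` of the application of Lemma 6.1 and the integrals -/

/-- The box `[0, 2]^k` (the points `(x₁, …, v, …, x_k)` with `v ∈ [0, 2]` occurring in `F̃`). [folklore] -/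
def maynardBigBox (k : ℕ) : Set (Fin k → ℝ) := Set.pi Set.univ fun _ => Set.Icc 0 2

/-- `[0, 2]^k` is compact. [folklore] -/
theorem isCompact_maynardBigBox (k : ℕ) : IsCompact (maynardBigBox k) :=
  isCompact_univ_pi fun _ => isCompact_Icc

/-- `x` with a coordinate replaced by `v ∈ [0, 2]` stays in `[0, 2]^k` if `x ∈ [0, 1]^k`. [folklore] -/
theorem update_mem_maynardBigBox {k : ℕ} {x : Fin k → ℝ} (hx : ∀ i, 0 ≤ x i ∧ x i ≤ 1)
    (m : Fin k) {v : ℝ} (hv0 : 0 ≤ v) (hv2 : v ≤ 2) : Function.update x m v ∈ maynardBigBox k := by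
  intro i _
  by_cases hi : i = m
  · subst hi; simp [hv0, hv2]
  · rw [Function.update_of_ne hi]
    exact ⟨(hx i).1, (hx i).2.trans one_le_two⟩

/-- `F̃(t) = G(x₁, …, (1 − t) ℓ, …, x_k)` is `C¹` for `G ∈ C¹`. [folklore] -/
theorem contDiff_Ftilde {k : ℕ} {G : (Fin k → ℝ) → ℝ} (hG : ContDiff ℝ 1 G) (x : Fin k → ℝ)
    (m : Fin k) (ℓ : ℝ) : ContDiff ℝ 1 (fun t : ℝ => G (Function.update x m ((1 - t) * ℓ))) := by
  have h1 : ContDiff ℝ 1 (fun t : ℝ => (1 - t) * ℓ) := (contDiff_const.sub contDiff_id).mul contDiff_const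
  exact hG.comp ((contDiff_update 1 x m).comp h1)

/-- `|F̃'(t)| ≤ 2 M₁` on `[0, 1]` if `‖∇G‖ ≤ M₁` on `[0, 2]^k`, `x ∈ [0,1]^k`, `0 ≤ ℓ ≤ 2`
(`F̃'(t) = −ℓ ∂_m G`). [folklore] -/
theorem abs_deriv_Ftilde_le {k : ℕ} {G : (Fin k → ℝ) → ℝ} (hG : ContDiff ℝ 1 G) {M₁ : ℝ}
    (hM₁ : ∀ p ∈ maynardBigBox k, ‖fderiv ℝ G p‖ ≤ M₁) {x : Fin k → ℝ}
    (hx : ∀ i, 0 ≤ x i ∧ x i ≤ 1) (m : Fin k) {ℓ : ℝ} (hℓ0 : 0 ≤ ℓ) (hℓ2 : ℓ ≤ 2) {t : ℝ}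
    (ht : t ∈ Set.Icc (0 : ℝ) 1) :
    |deriv (fun t : ℝ => G (Function.update x m ((1 - t) * ℓ))) t| ≤ 2 * M₁ := by
  set pt := Function.update x m ((1 - t) * ℓ) with hpt
  have hv0 : 0 ≤ (1 - t) * ℓ := mul_nonneg (by linarith [ht.2]) hℓ0
  have hv2 : (1 - t) * ℓ ≤ 2 := by nlinarith [ht.1, ht.2]
  have hptmem : pt ∈ maynardBigBox k := update_mem_maynardBigBox hx m hv0 hv2
  have hM0 : 0 ≤ M₁ := le_trans (norm_nonneg _) (hM₁ pt hptmem)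
  have hGd : HasFDerivAt G (fderiv ℝ G pt) pt := (hG.differentiable one_ne_zero pt).hasFDerivAt
  have ha : HasDerivAt (fun t : ℝ => (1 - t) * ℓ) (-ℓ) t := by
    simpa using ((hasDerivAt_id t).const_sub 1).mul_const ℓ
  have hb := hasDerivAt_update x m ((1 - t) * ℓ)
  have hinner : HasDerivAt (fun t : ℝ => Function.update x m ((1 - t) * ℓ))
      ((-ℓ) • Pi.single m (1 : ℝ)) t := by
    have h := hb.scomp t ha
    exact h
  have hcomp : HasDerivAt (fun t : ℝ => G (Function.update x m ((1 - t) * ℓ)))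
      (fderiv ℝ G pt ((-ℓ) • Pi.single m (1 : ℝ))) t := hGd.comp_hasDerivAt t hinner
  rw [hcomp.deriv]
  calc |fderiv ℝ G pt ((-ℓ) • Pi.single m (1 : ℝ))| = ‖fderiv ℝ G pt ((-ℓ) • Pi.single m (1 : ℝ))‖ :=
        (Real.norm_eq_abs _).symm
    _ ≤ ‖fderiv ℝ G pt‖ * ‖(-ℓ) • Pi.single m (1 : ℝ)‖ := ContinuousLinearMap.le_opNorm _ _
    _ = ‖fderiv ℝ G pt‖ * ℓ := by
        rw [norm_smul, Pi.norm_single, norm_one, mul_one, Real.norm_eq_abs, abs_neg, abs_of_nonneg hℓ0]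
    _ ≤ M₁ * 2 := mul_le_mul (hM₁ pt hptmem) hℓ2 hℓ0 hM0
    _ = 2 * M₁ := by ring

/-- `v ↦ (G · 1_{R_k})(x₁, …, v, …, x_k)` is interval integrable (`G` continuous). [folklore] -/
theorem intervalIntegrable_indicator_update {k : ℕ} {G : (Fin k → ℝ) → ℝ} (hG : Continuous G)
    (x : Fin k → ℝ) (m : Fin k) (a b : ℝ) :
    IntervalIntegrable (fun v => (maynardSimplex k).indicator G (Function.update x m v)) volume a b := by
  have hcont : Continuous (fun v : ℝ => Function.update x m v) := continuous_const.update m continuous_id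
  have heq : (fun v => (maynardSimplex k).indicator G (Function.update x m v)) =
      ((fun v : ℝ => Function.update x m v) ⁻¹' maynardSimplex k).indicator (G ∘ fun v => Function.update x m v) := by
    funext v
    rw [Set.indicator_comp_right]
  rw [heq, intervalIntegrable_iff']
  exact ((hG.comp hcont).integrableOn_uIcc).indicator
    (hcont.measurable (measurableSet_maynardSimplex k))

/-- **`F^{(m)}_u = ∫₀^{1−s} G(x₁, …, v, …, x_k) dv`** for `u` with `uᵢ ≥ 1`, `u_m = 1`,
`s = ∑ log uᵢ/log R ≤ 1` (the cut-off to `R_k` restricts `t_m` to `[0, 1 − s]`).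
[cite: MaynardAnnals2015, proof of Lemma 6.3 (definition of F^(m)_r, p. 14)] -/
theorem maynardFm_eq_integral {k : ℕ} {G : (Fin k → ℝ) → ℝ} (hG : Continuous G) {R : ℝ}
    (hR : 1 < R) {m : Fin k} {u : Fin k → ℕ} (hum : u m = 1)
    (x : Fin k → ℝ) (hx : x = fun i => Real.log (u i) / Real.log R) (s : ℝ) (hsx : s = ∑ i, x i)
    (hs1 : s ≤ 1) :
    maynardFm k ((maynardSimplex k).indicator G) R m u =
      ∫ v in (0 : ℝ)..(1 - s), G (Function.update x m v) := by
  have hlogR : 0 < Real.log R := Real.log_pos hR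
  have hx0 : ∀ i, 0 ≤ x i := fun i => by
    rw [hx]; exact div_nonneg (Real.log_natCast_nonneg _) hlogR.le
  have hxm : x m = 0 := by rw [hx]; simp [hum]
  have hs0 : 0 ≤ s := by rw [hsx]; exact Finset.sum_nonneg fun i _ => hx0 i
  unfold maynardFm
  rw [← hx]
  rw [← intervalIntegral.integral_add_adjacent_intervals (b := 1 - s)
    (intervalIntegrable_indicator_update hG x m 0 (1 - s))
    (intervalIntegrable_indicator_update hG x m (1 - s) 1)]
  have h1 : ∫ v in (0 : ℝ)..(1 - s), (maynardSimplex k).indicator G (Function.update x m v) =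
      ∫ v in (0 : ℝ)..(1 - s), G (Function.update x m v) := by
    refine intervalIntegral.integral_congr fun v hv => ?_
    rw [Set.uIcc_of_le (by linarith)] at hv
    have hmem : Function.update x m v ∈ maynardSimplex k :=
      (update_mem_maynardSimplex_iff hx0 hxm hv.1).2 (by rw [← hsx]; linarith [hv.2])
    simp only [Set.indicator_of_mem hmem]
  have h2 : ∫ v in (1 - s)..(1 : ℝ), (maynardSimplex k).indicator G (Function.update x m v) = 0 := by
    rw [intervalIntegral.integral_of_le (by linarith)]
    rw [MeasureTheory.setIntegral_congr_fun measurableSet_Ioc (g := fun _ => (0 : ℝ)) (fun v hv => ?_)]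
    · simp
    · have hv0 : 0 ≤ v := by linarith [hv.1]
      rw [Set.indicator_of_notMem]
      intro hmem
      have := (update_mem_maynardSimplex_iff hx0 hxm hv0).1 hmem
      rw [← hsx] at this
      linarith [hv.1]
  rw [h1, h2, add_zero]

/-- The main term of Lemma 6.1 for `F̃`, `κ = 1`: `log z · ∫₀¹ F̃(1 − t) dt = log R · ∫₀^ℓ G(…, v, …) dv`,
`ℓ = log z/log R` (substitution `v = t ℓ`). [folklore] -/
theorem log_mul_integral_Ftilde {k : ℕ} (G : (Fin k → ℝ) → ℝ) (x : Fin k → ℝ) (m : Fin k) {R : ℝ}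
    (hR : 1 < R) {z : ℕ} (hz : 2 ≤ z) (ℓ : ℝ) (hℓ : ℓ = Real.log z / Real.log R) :
    Real.log z * ∫ t in (0 : ℝ)..1, G (Function.update x m ((1 - (1 - t)) * ℓ)) =
      Real.log R * ∫ v in (0 : ℝ)..ℓ, G (Function.update x m v) := by
  have hlogR : 0 < Real.log R := Real.log_pos hR
  have hlogz : 0 < Real.log z := Real.log_pos (by exact_mod_cast (show 1 < z by omega))
  have hℓ0 : ℓ ≠ 0 := by rw [hℓ]; positivity
  have h1 : ∫ t in (0 : ℝ)..1, G (Function.update x m ((1 - (1 - t)) * ℓ)) =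
      ∫ t in (0 : ℝ)..1, (fun v => G (Function.update x m v)) (t * ℓ) := by
    refine intervalIntegral.integral_congr fun t _ => ?_
    simp only [sub_sub_cancel]
  rw [h1, intervalIntegral.integral_comp_mul_right (fun v => G (Function.update x m v)) hℓ0,
    zero_mul, one_mul, smul_eq_mul, hℓ]
  field_simp

/-- `|∫₀^b f − ∫₀^a f| ≤ M (b − a)` for `a ≤ b` when `f` is interval-integrable on `(0, a)`, `(0, b)`
and `|f| ≤ M` on `[a, b]`. [folklore] -/
theorem abs_integral_sub_integral_le {f : ℝ → ℝ} {a b M : ℝ} (hab : a ≤ b)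
    (hfa : IntervalIntegrable f volume 0 a) (hfb : IntervalIntegrable f volume 0 b)
    (hM : ∀ v ∈ Set.Icc a b, |f v| ≤ M) :
    |(∫ v in (0 : ℝ)..b, f v) - ∫ v in (0 : ℝ)..a, f v| ≤ M * (b - a) := by
  rw [intervalIntegral.integral_interval_sub_left hfb hfa]
  have h := intervalIntegral.norm_integral_le_of_norm_le_const (a := a) (b := b) (C := M) (f := f)
    (fun v hv => by
      rw [Set.uIoc_of_le hab] at hv
      rw [Real.norm_eq_abs]; exact hM v ⟨hv.1.le, hv.2⟩)
  rw [abs_of_nonneg (sub_nonneg.2 hab)] at h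
  rwa [Real.norm_eq_abs] at h


/-! ### Vanishing of `F^{(m)}` and of the `u`-sum off the simplex -/

/-- If `∑ xᵢ > 1` (`x ≥ 0`, `x_m = 0`) then `F^{(m)} = 0`: no `t_m ∈ [0, 1]` puts the point in `R_k`. [folklore] -/
theorem maynardFm_eq_zero_of_sum_gt {k : ℕ} (G : (Fin k → ℝ) → ℝ) (R : ℝ) {m : Fin k}
    {r : Fin k → ℕ} (x : Fin k → ℝ) (hx : x = fun i => Real.log (r i) / Real.log R)
    (hx0 : ∀ i, 0 ≤ x i) (hxm : x m = 0) (hgt : 1 < ∑ i, x i) :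
    maynardFm k ((maynardSimplex k).indicator G) R m r = 0 := by
  unfold maynardFm
  rw [← hx]
  have h : ∫ v in (0 : ℝ)..1, (maynardSimplex k).indicator G (Function.update x m v) =
      ∫ v in (0 : ℝ)..1, (0 : ℝ) := by
    refine intervalIntegral.integral_congr fun v hv => ?_
    rw [Set.uIcc_of_le zero_le_one] at hv
    rw [Set.indicator_of_notMem]
    intro hmem
    have := (update_mem_maynardSimplex_iff hx0 hxm hv.1).1 hmem
    linarith [hv.1]
  rw [h, intervalIntegral.integral_zero]

/-! ### Eventual inequalities in `N` -/

/-- `R = N^{θ/2−δ} → ∞`. [folklore] -/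
theorem tendsto_maynardR_atTop {θ δ : ℝ} (hη : 0 < θ / 2 - δ) :
    Tendsto (fun N : ℕ => maynardR θ δ N) atTop atTop :=
  (tendsto_rpow_atTop hη).comp tendsto_natCast_atTop_atTop

/-- Eventually `(log log R + K₀) · D₀ ≤ log R` (`D₀ ≤ log log N`, `log log R = log log N + O(1)`,
`(log log N)² = o(log N)`): the bound `L ≪ log log N` of the proof of Lemma 6.3 makes the error
`O(c_γ L F_max)` of Lemma 6.1 an `O(F_max φ(W) log R/(W D₀))`. [cite: MaynardAnnals2015, proof of Lemma 6.3 (the bound L ≪ log log N, p. 14)] -/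
theorem eventually_loglog_mul_maynardD0_le {θ δ : ℝ} (hη : 0 < θ / 2 - δ) (K₀ : ℝ) :
    ∀ᶠ N : ℕ in atTop, (Real.log (Real.log (maynardR θ δ N)) + K₀) * (maynardD0 N : ℝ) ≤
      Real.log (maynardR θ δ N) := by
  set η := θ / 2 - δ with hηdef
  set K₁ := |Real.log η| + |K₀| with hK₁
  -- `(log log N)^2 = o(log N)`
  have hLL : Tendsto (fun N : ℕ => Real.log (Real.log (N : ℝ))) atTop atTop :=
    Real.tendsto_log_atTop.comp (Real.tendsto_log_atTop.comp tendsto_natCast_atTop_atTop)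
  have hsmall : (fun N : ℕ => Real.log (Real.log (N : ℝ)) ^ (2 : ℝ)) =o[atTop] fun N : ℕ => Real.log N := by
    have h := (isLittleO_log_rpow_rpow_atTop (2 : ℝ) one_pos).comp_tendsto
      (Real.tendsto_log_atTop.comp tendsto_natCast_atTop_atTop)
    refine h.congr' EventuallyEq.rfl ?_
    filter_upwards with N
    simp [Function.comp]
  have hb := hsmall.bound (show 0 < η / 4 by positivity)
  have hK : ∀ᶠ N : ℕ in atTop, 2 * K₁ ^ 2 ≤ η / 2 * Real.log N :=
    (tendsto_atTop.1 ((Real.tendsto_log_atTop.comp tendsto_natCast_atTop_atTop).const_mul_atTop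
      (show 0 < η / 2 by positivity))) _
  filter_upwards [hb, hK, hLL.eventually_ge_atTop 1, eventually_ge_atTop 3] with N hbN hKN hLL1 hN3
  have hN1 : 1 ≤ N := by omega
  have hN0 : (0 : ℝ) < N := by exact_mod_cast (show 0 < N by omega)
  have hlogN : 0 < Real.log N := Real.log_pos (by exact_mod_cast (show 1 < N by omega))
  have hlogR : Real.log (maynardR θ δ N) = η * Real.log N := log_maynardR hN1
  set LL := Real.log (Real.log (N : ℝ)) with hLLdef
  have hLL0 : 0 < LL := by linarith
  -- `D₀ ≤ log log N`
  have hD : (maynardD0 N : ℝ) ≤ LL := by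
    unfold maynardD0
    calc (⌊Real.log (Real.log (Real.log (N : ℝ)))⌋₊ : ℝ) ≤ Real.log LL := Nat.floor_le (Real.log_nonneg hLL1)
      _ ≤ LL := Real.log_le_self hLL0.le
  -- `log log R ≤ log log N + |log η|`
  have hllR : Real.log (Real.log (maynardR θ δ N)) ≤ LL + |Real.log η| := by
    rw [hlogR, Real.log_mul hη.ne' hlogN.ne']
    linarith [le_abs_self (Real.log η)]
  have hb' : LL ^ 2 ≤ η / 4 * Real.log N := by
    have := hbN
    rw [Real.norm_of_nonneg (by positivity), Real.norm_of_nonneg hlogN.le] at this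
    rwa [Real.rpow_two] at this
  calc (Real.log (Real.log (maynardR θ δ N)) + K₀) * (maynardD0 N : ℝ)
      ≤ (LL + K₁) * LL := by
        have h1 : Real.log (Real.log (maynardR θ δ N)) + K₀ ≤ LL + K₁ := by
          rw [hK₁]; linarith [le_abs_self K₀]
        have h2 : 0 ≤ LL + K₁ := by positivity
        calc (Real.log (Real.log (maynardR θ δ N)) + K₀) * (maynardD0 N : ℝ)
            ≤ (LL + K₁) * (maynardD0 N : ℝ) := by gcongr
          _ ≤ (LL + K₁) * LL := by gcongr
    _ ≤ 2 * LL ^ 2 + 2 * K₁ ^ 2 := by nlinarith [sq_nonneg (LL - K₁)]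
    _ ≤ 2 * (η / 4 * Real.log N) + η / 2 * Real.log N := by gcongr
    _ = Real.log (maynardR θ δ N) := by rw [hlogR]; ring


/-! ### The evaluation of `y^{(m)}` (Maynard 2015, proof of Lemma 6.3): discharge of `maynard_lemma63_ym` -/

/-- `|a + b + c + d| ≤ |a| + |b| + |c| + |d|`. [folklore] -/
theorem abs_add_four_le (a b c d : ℝ) : |a + b + c + d| ≤ |a| + |b| + |c| + |d| := by
  have h1 := abs_add_le (a + b + c) d
  have h2 := abs_add_le (a + b) c
  have h3 := abs_add_le a b
  linarith

set_option maxHeartbeats 1600000 in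
/-- **Maynard 2015, proof of Lemma 6.3, the evaluation of `y^{(m)}`, from Lemma 6.1** (= GGPY Lemma 4 with
`κ = 1`, `GGPY.moebiusSqGSumWeighted_asymptotic`): for `r_m = 1`, `∏ rᵢ` squarefree and coprime to `W`,
`y^{(m)}_r = (log R)(φ(W)/W)(∏ φ(rᵢ)/rᵢ) F^{(m)}_r + O(F_max φ(W) log R/(W D₀))` uniformly in `r`.
Along the printed proof (p. 14): Lemma 5.3 (`MaynardSieve.abs_ym_sub_main_le`, with
`L ≪ φ(W) log R/W`, `Z − 1 ≪ 1/D₀`, and `κ(r) = 1 + O(k/D₀)`), the `u`-sum written as a weighted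
sum `∑_{d<z} μ² g F̃` for `γ = 1_{p ∤ W∏rᵢ}` (`Mterm_eq_moebiusSqGSumWeighted`, `z = ⌊R^{1−s}⌋ + 1`,
`s = ∑ log rᵢ/log R`), Lemma 6.1 with `κ = 1`, `A₁ = 2`, `A₂ = 10`, `L = 6 + ∑_{p∣W∏rᵢ} log p/p ≪ log log N`
(`hypOmega2_gammaInd`, `sum_primeFactors_log_div_le`, `eventually_loglog_mul_maynardD0_le`),
`c_γ = (φ(W)/W) ∏ φ(rᵢ)/rᵢ` (`cGamma_gammaInd`), and the main term
`c_γ log z ∫₀¹ F̃(1 − t) dt = c_γ log R ∫₀^ℓ G = c_γ log R (F^{(m)}_r + O(F_max log 2/log R))`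
(`log_mul_integral_Ftilde`, `maynardFm_eq_integral`). [cite: MaynardAnnals2015, proof of Lemma 6.3 (evaluation of y^(m), p. 14)] -/
theorem maynard_lemma63_ym_of_GGPY (h4 : GGPY.moebiusSqGSumWeighted_asymptotic) :
    maynard_lemma63_ym := by
  intro k θ δ hδ hη G hG m
  classical
  set η := θ / 2 - δ with hηdef
  set F := (maynardSimplex k).indicator G with hFdef
  -- bounds for `G`, `∇G` on `[0,2]^k`
  obtain ⟨M₀', hM₀'⟩ := (isCompact_maynardBigBox k).exists_bound_of_continuousOn
    hG.continuous.continuousOn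
  obtain ⟨M₁', hM₁'⟩ := (isCompact_maynardBigBox k).exists_bound_of_continuousOn
    (hG.continuous_fderiv one_ne_zero).continuousOn
  set M₀ := max M₀' 1 with hM₀def
  set M₁ := max M₁' 0 with hM₁def
  have hM₀pos : 0 < M₀ := lt_of_lt_of_le one_pos (le_max_right _ _)
  have hM₁0 : 0 ≤ M₁ := le_max_right _ _
  have hGbox : ∀ p ∈ maynardBigBox k, |G p| ≤ M₀ := fun p hp => by
    have := hM₀' p hp; rw [Real.norm_eq_abs] at this; exact this.trans (le_max_left _ _)
  have hG'box : ∀ p ∈ maynardBigBox k, ‖fderiv ℝ G p‖ ≤ M₁ := fun p hp =>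
    (hM₁' p hp).trans (le_max_left _ _)
  -- the constant of Lemma 6.1 (`κ = 1`, `A₁ = 2`, `A₂ = 10`)
  obtain ⟨C₄, hC₄⟩ := h4 2 10 two_pos (by norm_num)
  set bL := 2 + SquarefreeSums.bConst 2 with hbLdef
  have hbL0 : 0 ≤ bL := by
    have := SquarefreeSums.one_le_bConst (show (0 : ℝ) ≤ 2 by norm_num); rw [hbLdef]; linarith
  set K₀ : ℝ := (k : ℝ) + 9 with hK₀def
  set Ctot := 4 * (k : ℝ) * bL * 3 ^ k * M₀ + 2 * (k : ℝ) * M₀ * bL + |C₄| * (M₀ + 2 * M₁) + M₀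
    with hCtotdef
  have hCtot0 : 0 ≤ Ctot := by positivity
  refine ⟨Ctot, ?_⟩
  filter_upwards [eventually_two_le_maynardD0,
    (tendsto_maynardR_atTop hη).eventually_ge_atTop (Real.exp 3),
    eventually_sum_inv_totient_le hη, eventually_loglog_mul_maynardD0_le hη K₀,
    eventually_ge_atTop 1] with N hD2 hR3 hLφ hLD hN1
  -- fixed-`N` notation and basic facts
  set W := maynardW N with hWdef
  set R := maynardR θ δ N with hRdef
  set D := maynardD0 N with hDdef
  set B := ⌊R⌋₊ with hBdef
  have hW0 : W ≠ 0 := (primorial_pos _).ne'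
  have hWpos : (0 : ℝ) < W := by exact_mod_cast primorial_pos _
  have hφpos : (0 : ℝ) < W.totient := by exact_mod_cast Nat.totient_pos.2 (primorial_pos _)
  have h2W : 2 ∣ W := dvd_maynardW_of_prime_le Nat.prime_two hD2
  have hDW : ∀ p, p.Prime → p ≤ D → p ∣ W := fun p hp hle => dvd_maynardW_of_prime_le hp hle
  have he3 : (1 : ℝ) < Real.exp 3 := by
    have := Real.add_one_le_exp (3 : ℝ); linarith only [this]
  have hR1 : 1 < R := lt_of_lt_of_le he3 hR3
  have hR0 : 0 < R := by linarith only [hR1]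
  have hlogR3 : 3 ≤ Real.log R := by
    rw [Real.le_log_iff_exp_le hR0]; exact hR3
  have hlogR : 0 < Real.log R := by linarith only [hlogR3]
  have hD2r : (2 : ℝ) ≤ D := by exact_mod_cast hD2
  have hDpos : (0 : ℝ) < D := by linarith only [hD2r]
  have hk0 : (0 : ℝ) ≤ k := Nat.cast_nonneg k
  set φW := (W.totient : ℝ) / W with hφWdef
  have hφW0 : 0 < φW := div_pos hφpos hWpos
  have hφW1 : φW ≤ 1 := by
    rw [hφWdef, div_le_one hWpos]; exact_mod_cast Nat.totient_le W
  set Pw := φW * Real.log R with hPwdef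
  have hPw0 : 0 < Pw := mul_pos hφW0 hlogR
  -- from `hLD`: `D ≤ log R / 9`, so `D ≤ log R` and `D log 4 ≤ log R`
  have hllR0 : 0 ≤ Real.log (Real.log R) := Real.log_nonneg (by linarith)
  have hK₀9 : (9 : ℝ) ≤ K₀ := by
    rw [hK₀def]; have : (0:ℝ) ≤ k := Nat.cast_nonneg k; linarith only [this]
  have hDK : (D : ℝ) * K₀ ≤ Real.log R := by
    calc (D : ℝ) * K₀ = K₀ * D := mul_comm _ _
      _ ≤ (Real.log (Real.log R) + K₀) * D :=
          mul_le_mul_of_nonneg_right (by linarith only [hllR0]) hDpos.le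
      _ ≤ Real.log R := hLD
  have hDlog : (D : ℝ) ≤ Real.log R := by
    calc (D : ℝ) = D * 1 := (mul_one _).symm
      _ ≤ D * K₀ := mul_le_mul_of_nonneg_left (by linarith only [hK₀9]) hDpos.le
      _ ≤ Real.log R := hDK
  have hDlog4 : (D : ℝ) * Real.log 4 ≤ Real.log R := by
    have h4 : Real.log 4 ≤ 9 := by
      have := Real.log_le_sub_one_of_pos (show (0:ℝ) < 4 by norm_num); linarith only [this]
    calc (D : ℝ) * Real.log 4 ≤ D * K₀ := mul_le_mul_of_nonneg_left (by linarith only [h4, hK₀9]) hDpos.le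
      _ ≤ Real.log R := hDK
  -- the target's right-hand side is `Ctot · Pw / D`
  have hRHS : Ctot * ((W.totient : ℝ) / W) * Real.log R / (D : ℝ) = Ctot * Pw / D := by
    rw [hPwdef, hφWdef]; ring
  intro r hrm hsq hco
  rw [hRHS]
  have hr0 : ∀ i, r i ≠ 0 := fun i h0 => by
    have : (∏ j, r j) = 0 := Finset.prod_eq_zero (Finset.mem_univ i) h0
    rw [this] at hsq; exact not_squarefree_zero hsq
  have hr1 : ∀ i, 1 ≤ r i := fun i => Nat.one_le_iff_ne_zero.2 (hr0 i)
  set x : Fin k → ℝ := fun i => Real.log (r i) / Real.log R with hxdef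
  have hx0 : ∀ i, 0 ≤ x i := fun i => div_nonneg (Real.log_natCast_nonneg _) hlogR.le
  have hxm : x m = 0 := by simp [hxdef, hrm]
  have hRHS0 : 0 ≤ Ctot * Pw / D := div_nonneg (mul_nonneg hCtot0 hPw0.le) hDpos.le
  by_cases hbox : r ∈ maynardBox k R
  swap
  · ---------------------------------------------------------------- Case A: `r` off the box
    have hym0 : maynardYm k F R W m r = 0 :=
      maynardYm_eq_zero_of_not_mem_boxG F R W m fun h => hbox (MaynardSieve.mem_boxG.1 h).1
    obtain ⟨j, hj⟩ : ∃ j, B < r j := by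
      by_contra hall
      push Not at hall
      exact hbox (mem_maynardBox_iff.2 fun i => ⟨hr1 i, hall i⟩)
    have hxj : 1 < x j := by
      have hrj : R < r j := by
        have h1 : R < (B : ℝ) + 1 := Nat.lt_floor_add_one R
        have h2 : (B : ℝ) + 1 ≤ r j := by exact_mod_cast hj
        linarith only [h1, h2]
      rw [hxdef]
      dsimp only
      rw [lt_div_iff₀ hlogR, one_mul]
      exact Real.log_lt_log hR0 hrj
    have hsum : 1 < ∑ i, x i :=
      lt_of_lt_of_le hxj (Finset.single_le_sum (fun i _ => hx0 i) (Finset.mem_univ j))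
    have hFm0 : maynardFm k F R m r = 0 := maynardFm_eq_zero_of_sum_gt G R x rfl hx0 hxm hsum
    rw [hym0, hFm0, mul_zero, sub_zero, abs_zero]
    exact hRHS0
  ------------------------------------------------------------------ Case B: `r` in the box
  have hu : r ∈ MaynardSieve.boxG k W B := MaynardSieve.mem_boxG.2 ⟨hbox, hsq, hco⟩
  have hrB : ∀ i, 1 ≤ r i ∧ r i ≤ B := fun i => mem_maynardBox_iff.1 hbox i
  have hx1 : ∀ i, x i ≤ 1 := fun i => by
    rw [hxdef]; dsimp only
    rw [div_le_one hlogR]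
    refine Real.log_le_log (by exact_mod_cast hr1 i) ?_
    exact le_trans (by exact_mod_cast (hrB i).2) (Nat.floor_le hR0.le)
  have hx01 : ∀ i, 0 ≤ x i ∧ x i ≤ 1 := fun i => ⟨hx0 i, hx1 i⟩
  set s := ∑ i, x i with hsdef
  have hs0 : 0 ≤ s := Finset.sum_nonneg fun i _ => hx0 i
  -- Lemma 5.3 and the sizes of `L_φ`, `Z`, `κ`
  set y := maynardY k F R W with hydef
  have hy : MaynardSieve.SupportedOn W B y := supportedOn_maynardY _ F R W
  have hymax : ∀ r', |y r'| ≤ M₀ := abs_maynardY_le k G R W hM₀pos.le fun t ht =>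
    hGbox t fun i _ =>
      have h1 := maynardSimplex_subset_maynardCube k ht i (Set.mem_univ i)
      ⟨h1.1, h1.2.trans one_le_two⟩
  have h53 := MaynardSieve.abs_ym_sub_main_le h2W hy hymax hu hrm
  have hYm : maynardYm k F R W m r = MaynardSieve.ym W B y m r := maynardYm_eq_ym F R W m r
  set Lφ := ∑ n ∈ MaynardSieve.G1 W B, 1 / (n.totient : ℝ) with hLφdef
  set Z := ∑ n ∈ MaynardSieve.G1 W B, 1 / (n.totient : ℝ) ^ 2 with hZdef
  have hLφ0 : 0 ≤ Lφ := Finset.sum_nonneg fun n _ => by positivity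
  have hLφle : Lφ ≤ bL * Pw := hLφ
  have h1G : 1 ∈ MaynardSieve.G1 W B := by
    rw [MaynardSieve.mem_G1]
    exact ⟨⟨le_rfl, Nat.le_floor (by exact_mod_cast hR1.le)⟩, squarefree_one, Nat.coprime_one_left W⟩
  have hZ1 : 1 ≤ Z := by
    have := Finset.single_le_sum (f := fun n : ℕ => 1 / ((n.totient : ℕ) : ℝ) ^ 2)
      (fun n _ => by positivity) h1G
    rw [Nat.totient_one, Nat.cast_one, one_pow, div_one] at this
    exact this
  have hZ0 : 0 ≤ Z := by linarith only [hZ1]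
  have hZle : Z ≤ Real.exp (1 / ((D : ℝ) - 1)) := sum_inv_totient_sq_le hD2 hDW
  have hD1pos : 0 < (D : ℝ) - 1 := by linarith only [hD2r]
  have hinvD : 1 / ((D : ℝ) - 1) ≤ 1 := by rw [div_le_one hD1pos]; linarith only [hD2r]
  have hinvD' : 1 / ((D : ℝ) - 1) ≤ 2 / D := by
    rw [div_le_div_iff₀ hD1pos hDpos]; linarith only [hD2r]
  have hZsub : Z - 1 ≤ 4 / D := by
    have hnn : 0 ≤ 1 / ((D : ℝ) - 1) := one_div_nonneg.2 hD1pos.le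
    have h1 : Real.exp (1 / ((D : ℝ) - 1)) - 1 ≤ 2 * (1 / ((D : ℝ) - 1)) := by
      have habs : |1 / ((D : ℝ) - 1)| ≤ 1 := by rw [abs_of_nonneg hnn]; exact hinvD
      have := Real.abs_exp_sub_one_le habs
      rw [abs_of_nonneg hnn] at this
      exact (le_abs_self _).trans this
    calc Z - 1 ≤ Real.exp (1 / ((D : ℝ) - 1)) - 1 := by linarith only [hZle]
      _ ≤ 2 * (1 / ((D : ℝ) - 1)) := h1
      _ ≤ 2 * (2 / D) := by linarith only [hinvD']
      _ = 4 / D := by ring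
  have hZ3 : Z ≤ 3 := by
    have h1 : Real.exp (1 / ((D : ℝ) - 1)) ≤ Real.exp 1 := Real.exp_le_exp.2 hinvD
    have h2 := Real.exp_one_lt_d9
    linarith only [hZle, h1, h2]
  have hM₀0 : 0 ≤ M₀ := hM₀pos.le
  have hbLPw : 0 ≤ bL * Pw := mul_nonneg hbL0 hPw0.le
  have hκ1 := MaynardSieve.kappa_le_one hu
  have hκ0 := MaynardSieve.kappa_pos h2W hu
  have hκlo := MaynardSieve.one_sub_le_kappa hD2 hDW hu
  -- `|y^{(m)} − κ M| ≤ 4 k bL 3^k M₀ · Pw/D`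
  have hE53 : |MaynardSieve.ym W B y m r - MaynardSieve.kappa r * MaynardSieve.Mterm B y m r| ≤
      4 * (k : ℝ) * bL * 3 ^ k * M₀ * Pw / D := by
    refine h53.trans ?_
    have hZ1' : 0 ≤ Z - 1 := by linarith only [hZ1]
    have hκ0' : 0 ≤ MaynardSieve.kappa r := hκ0.le
    have h1 : Lφ * ((Z - 1) * Z ^ k) ≤ (bL * Pw) * ((4 / D) * 3 ^ k) :=
      mul_le_mul hLφle (mul_le_mul hZsub (pow_le_pow_left₀ hZ0 hZ3 k) (pow_nonneg hZ0 k)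
        (by positivity)) (mul_nonneg hZ1' (pow_nonneg hZ0 k)) hbLPw
    have h2 : M₀ * MaynardSieve.kappa r ≤ M₀ * 1 := mul_le_mul_of_nonneg_left hκ1 hM₀0
    calc M₀ * MaynardSieve.kappa r * ((k : ℝ) * (Lφ * ((Z - 1) * Z ^ k)))
        ≤ M₀ * 1 * ((k : ℝ) * ((bL * Pw) * ((4 / D) * 3 ^ k))) :=
          mul_le_mul h2 (mul_le_mul_of_nonneg_left h1 hk0) (mul_nonneg hk0 (mul_nonneg hLφ0
            (mul_nonneg hZ1' (pow_nonneg hZ0 k)))) (by rw [mul_one]; exact hM₀0)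
      _ = 4 * (k : ℝ) * bL * 3 ^ k * M₀ * Pw / D := by ring
  -- `|M| ≤ M₀ L_φ`
  have hMabs : |MaynardSieve.Mterm B y m r| ≤ M₀ * Lφ := MaynardSieve.abs_Mterm_le hy hymax r
  -- `|κ M − M| ≤ 2 k M₀ bL · Pw/D`
  have hEκ : |MaynardSieve.kappa r * MaynardSieve.Mterm B y m r - MaynardSieve.Mterm B y m r| ≤
      2 * (k : ℝ) * M₀ * bL * Pw / D := by
    rw [← sub_one_mul, abs_mul]
    have h1 : |MaynardSieve.kappa r - 1| ≤ (k : ℝ) / ((D : ℝ) - 1) := by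
      rw [abs_sub_comm, abs_of_nonneg (by linarith only [hκ1])]; linarith only [hκlo]
    have hkD : 0 ≤ (k : ℝ) / ((D : ℝ) - 1) := div_nonneg hk0 hD1pos.le
    calc |MaynardSieve.kappa r - 1| * |MaynardSieve.Mterm B y m r|
        ≤ (k : ℝ) / ((D : ℝ) - 1) * (M₀ * Lφ) := mul_le_mul h1 hMabs (abs_nonneg _) hkD
      _ ≤ (k : ℝ) * (2 / D) * (M₀ * (bL * Pw)) := by
          have : (k : ℝ) / ((D : ℝ) - 1) = k * (1 / ((D : ℝ) - 1)) := by ring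
          rw [this]
          exact mul_le_mul (mul_le_mul_of_nonneg_left hinvD' hk0)
            (mul_le_mul_of_nonneg_left hLφle hM₀0) (mul_nonneg hM₀0 hLφ0)
            (mul_nonneg hk0 (by positivity))
      _ = 2 * (k : ℝ) * M₀ * bL * Pw / D := by ring
  by_cases hs1 : s ≤ 1
  swap
  · ---------------------------------------------------------------- Case B1: `s > 1`
    push Not at hs1
    have hFm0 : maynardFm k F R m r = 0 := maynardFm_eq_zero_of_sum_gt G R x rfl hx0 hxm hs1
    have hMt0 : MaynardSieve.Mterm B y m r = 0 := by
      unfold MaynardSieve.Mterm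
      refine Finset.sum_eq_zero fun a ha => ?_
      rw [hydef, hFdef, maynardY_update_eq G R W hu hrm ha]
      have ha1 : 1 ≤ a := (Finset.mem_Icc.1 ha).1
      have hv : 0 ≤ Real.log a / Real.log R := div_nonneg (Real.log_natCast_nonneg _) hlogR.le
      split_ifs with hcond
      · rw [Set.indicator_of_notMem, zero_div]
        intro hmem
        have := (update_mem_maynardSimplex_iff hx0 hxm hv).1 hmem
        linarith only [this, hs1, hv]
      · rw [zero_div]
    rw [hYm, hFm0, mul_zero, sub_zero]
    rw [hMt0, mul_zero, sub_zero] at hE53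
    refine hE53.trans ?_
    rw [hCtotdef]
    have : 0 ≤ (2 * (k : ℝ) * M₀ * bL + |C₄| * (M₀ + 2 * M₁) + M₀) * Pw / D :=
      div_nonneg (mul_nonneg (by positivity) hPw0.le) hDpos.le
    calc 4 * (k : ℝ) * bL * 3 ^ k * M₀ * Pw / D
        ≤ 4 * (k : ℝ) * bL * 3 ^ k * M₀ * Pw / D + (2 * (k : ℝ) * M₀ * bL + |C₄| * (M₀ + 2 * M₁) + M₀) * Pw / D :=
          le_add_of_nonneg_right this
      _ = _ := by ring
  ------------------------------------------------------------------ Case B2: `s ≤ 1`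
  set z : ℕ := ⌊R ^ (1 - s)⌋₊ + 1 with hzdef
  set ℓ : ℝ := Real.log z / Real.log R with hℓdef
  set P : ℕ := W * ∏ i, r i with hPdef
  have hP0 : P ≠ 0 := mul_ne_zero hW0 (Finset.prod_ne_zero_iff.2 fun i _ => hr0 i)
  set Ft : ℝ → ℝ := fun t => G (Function.update x m ((1 - t) * ℓ)) with hFtdef
  -- `z ≥ 2` and the position of `ℓ`
  have hRs1 : 1 ≤ R ^ (1 - s) := Real.one_le_rpow hR1.le (by linarith only [hs1])
  have hRs0 : 0 < R ^ (1 - s) := by linarith only [hRs1]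
  have hz2 : 2 ≤ z := by
    have : 1 ≤ ⌊R ^ (1 - s)⌋₊ := Nat.le_floor (by exact_mod_cast hRs1)
    rw [hzdef]; omega
  have hz2r : (2 : ℝ) ≤ z := by exact_mod_cast hz2
  have hzgt : R ^ (1 - s) < z := by
    rw [hzdef]; push_cast; exact Nat.lt_floor_add_one _
  have hzle : (z : ℝ) ≤ 2 * R ^ (1 - s) := by
    rw [hzdef]; push_cast
    have := Nat.floor_le hRs0.le
    linarith only [this, hRs1]
  have hlogRs : Real.log (R ^ (1 - s)) = (1 - s) * Real.log R := Real.log_rpow hR0 _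
  have hlogz_lo : (1 - s) * Real.log R < Real.log z := by
    rw [← hlogRs]; exact Real.log_lt_log hRs0 hzgt
  have hlogz_hi : Real.log z ≤ Real.log 2 + (1 - s) * Real.log R := by
    rw [← hlogRs, ← Real.log_mul two_ne_zero hRs0.ne']
    exact Real.log_le_log (by positivity) hzle
  have hlog2 : Real.log 2 ≤ 1 := by have := Real.log_two_lt_d9; linarith only [this]
  have hℓlo : 1 - s ≤ ℓ := by
    rw [hℓdef, le_div_iff₀ hlogR]; linarith only [hlogz_lo]
  have hℓhi : ℓ ≤ 1 - s + Real.log 2 / Real.log R := by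
    rw [hℓdef, div_le_iff₀ hlogR, add_mul, div_mul_cancel₀ _ hlogR.ne']
    linarith only [hlogz_hi]
  have hℓ0 : 0 ≤ ℓ := by linarith only [hℓlo, hs1]
  have hℓ2 : ℓ ≤ 2 := by
    have : Real.log 2 / Real.log R ≤ 1 := by rw [div_le_one hlogR]; linarith only [hlog2, hlogR3]
    linarith only [this, hℓhi, hs0]
  -- `M = ∑_{d<z} μ² g F̃`
  have hM : MaynardSieve.Mterm B y m r = GGPY.moebiusSqGSumWeighted (gammaInd P) Ft z := by
    rw [hydef, hFdef]
    exact Mterm_eq_moebiusSqGSumWeighted G hR1 W hu hrm x rfl s rfl hs1 z rfl ℓ rfl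
  -- `L`, `1 ≤ L`, and `L · D ≤ log R`
  set L := 6 + ∑ p ∈ P.primeFactors, Real.log p / p with hLdef
  have hLsum0 : 0 ≤ ∑ p ∈ P.primeFactors, Real.log p / p := Finset.sum_nonneg fun p hp => by
    have := (Nat.prime_of_mem_primeFactors hp).pos; positivity
  have hL1 : 1 ≤ L := by rw [hLdef]; linarith only [hLsum0]
  have hL0 : 0 ≤ L := by linarith only [hL1]
  have hLle : L ≤ Real.log (Real.log R) + K₀ := by
    have h1 := sum_primeFactors_log_div_le hP0 hlogR3
    have hlogP : Real.log P ≤ D * Real.log 4 + k * Real.log R := by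
      have hP1 : (0 : ℝ) < ∏ i, (r i : ℝ) := Finset.prod_pos fun i _ => by exact_mod_cast hr1 i
      rw [hPdef, Nat.cast_mul, Nat.cast_prod, Real.log_mul hWpos.ne' hP1.ne',
        Real.log_prod (s := Finset.univ) (fun i _ => by exact_mod_cast hr0 i)]
      have hW4 : Real.log W ≤ D * Real.log 4 := by
        calc Real.log W ≤ Real.log ((4 : ℝ) ^ D) := Real.log_le_log hWpos (maynardW_le_four_pow N)
          _ = D * Real.log 4 := by rw [Real.log_pow]
      have hri : ∀ i, Real.log (r i) ≤ Real.log R := fun i =>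
        Real.log_le_log (by exact_mod_cast hr1 i)
          (le_trans (by exact_mod_cast (hrB i).2) (Nat.floor_le hR0.le))
      have hs : ∑ i, Real.log (r i : ℝ) ≤ ∑ _i : Fin k, Real.log R := Finset.sum_le_sum fun i _ => hri i
      have hs' : ∑ _i : Fin k, Real.log R = k * Real.log R := by
        rw [Finset.sum_const, Finset.card_univ, Fintype.card_fin, nsmul_eq_mul]
      linarith only [hs, hs', hW4]
    have hdiv : Real.log P / Real.log R ≤ 1 + k := by
      rw [div_le_iff₀ hlogR]
      have hk0 : (0 : ℝ) ≤ k * Real.log R := mul_nonneg (Nat.cast_nonneg k) hlogR.le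
      linarith only [hlogP, hDlog4, hk0]
    have hlog4 : Real.log 4 ≤ 2 := by
      rw [show (4 : ℝ) = 2 ^ 2 by norm_num, Real.log_pow]; push_cast; linarith only [hlog2]
    rw [hLdef, hK₀def]
    linarith only [h1, hdiv, hlog4]
  have hLDle : L * D ≤ Real.log R := by
    calc L * D ≤ (Real.log (Real.log R) + K₀) * D := by gcongr
      _ ≤ Real.log R := hLD
  -- Lemma 6.1 (Goldston–Graham–Pintz–Yıldırım, Lemma 4)
  have hFt_cd : ContDiff ℝ 1 Ft := contDiff_Ftilde hG x m ℓ
  have hFt_bd : ∀ t ∈ Set.Icc (0 : ℝ) 1, |Ft t| + |deriv Ft t| ≤ M₀ + 2 * M₁ := by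
    intro t ht
    have h1 : |Ft t| ≤ M₀ := by
      rw [hFtdef]
      refine hGbox _ (update_mem_maynardBigBox hx01 m ?_ ?_)
      · exact mul_nonneg (by linarith only [ht.2]) hℓ0
      · calc (1 - t) * ℓ ≤ 1 * ℓ := mul_le_mul_of_nonneg_right (by linarith only [ht.1]) hℓ0
          _ ≤ 2 := by rw [one_mul]; exact hℓ2
    have h2 : |deriv Ft t| ≤ 2 * M₁ := abs_deriv_Ftilde_le hG hG'box hx01 m hℓ0 hℓ2 ht
    linarith only [h1, h2]
  have hGG := hC₄ L hL1 (gammaInd P) (hypOmega1_gammaInd P) (hypOmega2_gammaInd hP0) Ft hFt_cd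
    (M₀ + 2 * M₁) hFt_bd (z : ℝ) hz2r
  set c := GGPY.cGamma (gammaInd P) with hcdef
  have hc : c = φW * ∏ i, ((r i).totient : ℝ) / (r i) := by
    rw [hcdef, cGamma_gammaInd hP0, hPdef, hφWdef]
    exact totient_mul_prod_div hW0 ⟨hsq, hco⟩
  have hprod := prod_totient_div_le_one r
  have hc0 : 0 ≤ c := by rw [hc]; exact mul_nonneg hφW0.le hprod.1
  have hcle : c ≤ φW := by rw [hc]; exact mul_le_of_le_one_right hφW0.le hprod.2
  have hmainGG : c * Real.log (z : ℝ) * ∫ t in (0 : ℝ)..1, Ft (1 - t)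
        = c * (Real.log R * ∫ v in (0 : ℝ)..ℓ, G (Function.update x m v)) := by
    rw [mul_assoc]
    congr 1
    exact log_mul_integral_Ftilde G x m hR1 hz2 ℓ rfl
  rw [hmainGG] at hGG
  -- `F^{(m)}` as an integral, and `∫₀^ℓ` against `∫₀^{1−s}`
  have hFm : maynardFm k F R m r = ∫ v in (0 : ℝ)..(1 - s), G (Function.update x m v) :=
    maynardFm_eq_integral hG.continuous hR1 hrm x rfl s rfl hs1
  have hGint : ∀ c d : ℝ, IntervalIntegrable (fun v => G (Function.update x m v)) volume c d :=
    fun c d => (hG.continuous.comp (continuous_const.update m continuous_id)).intervalIntegrable c d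
  have hIdiff : |(∫ v in (0 : ℝ)..ℓ, G (Function.update x m v)) -
      ∫ v in (0 : ℝ)..(1 - s), G (Function.update x m v)| ≤ M₀ * (ℓ - (1 - s)) := by
    refine abs_integral_sub_integral_le hℓlo (hGint _ _) (hGint _ _) fun v hv => hGbox _ (update_mem_maynardBigBox hx01 m ?_ ?_)
    · linarith only [hv.1, hs1]
    · linarith only [hv.2, hℓ2]
  have htarget : Real.log R * ((W.totient : ℝ) / W) * (∏ i, ((r i).totient : ℝ) / (r i)) *
      maynardFm k F R m r = c * (Real.log R * ∫ v in (0 : ℝ)..(1 - s), G (Function.update x m v)) := by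
    rw [hFm, hc, hφWdef]; ring
  -- assemble the four differences
  rw [hYm, htarget]
  have hsplit : MaynardSieve.ym W B y m r -
      c * (Real.log R * ∫ v in (0 : ℝ)..(1 - s), G (Function.update x m v)) =
      (MaynardSieve.ym W B y m r - MaynardSieve.kappa r * MaynardSieve.Mterm B y m r)
      + (MaynardSieve.kappa r * MaynardSieve.Mterm B y m r - MaynardSieve.Mterm B y m r)
      + (GGPY.moebiusSqGSumWeighted (gammaInd P) Ft z -
          c * (Real.log R * ∫ v in (0 : ℝ)..ℓ, G (Function.update x m v)))
      + c * Real.log R * ((∫ v in (0 : ℝ)..ℓ, G (Function.update x m v)) -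
          ∫ v in (0 : ℝ)..(1 - s), G (Function.update x m v)) := by
    rw [hM]; ring
  rw [hsplit]
  have hT3 : |GGPY.moebiusSqGSumWeighted (gammaInd P) Ft z -
      c * (Real.log R * ∫ v in (0 : ℝ)..ℓ, G (Function.update x m v))| ≤
      |C₄| * (M₀ + 2 * M₁) * Pw / D := by
    refine hGG.trans ?_
    have hM2 : 0 ≤ M₀ + 2 * M₁ := by linarith only [hM₀0, hM₁0]
    have hLM : 0 ≤ L * (M₀ + 2 * M₁) := mul_nonneg hL0 hM2
    have hCM : 0 ≤ |C₄| * (M₀ + 2 * M₁) := mul_nonneg (abs_nonneg _) hM2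
    calc C₄ * c * L * (M₀ + 2 * M₁) = C₄ * (c * (L * (M₀ + 2 * M₁))) := by ring
      _ ≤ |C₄| * (φW * (L * (M₀ + 2 * M₁))) :=
          mul_le_mul (le_abs_self C₄) (mul_le_mul_of_nonneg_right hcle hLM)
            (mul_nonneg hc0 hLM) (abs_nonneg _)
      _ = |C₄| * (M₀ + 2 * M₁) * (φW * (L * D)) / D := by field_simp
      _ ≤ |C₄| * (M₀ + 2 * M₁) * (φW * Real.log R) / D :=
          div_le_div_of_nonneg_right (mul_le_mul_of_nonneg_left
            (mul_le_mul_of_nonneg_left hLDle hφW0.le) hCM) hDpos.le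
      _ = |C₄| * (M₀ + 2 * M₁) * Pw / D := by rw [hPwdef]
  have hT4 : |c * Real.log R * ((∫ v in (0 : ℝ)..ℓ, G (Function.update x m v)) -
      ∫ v in (0 : ℝ)..(1 - s), G (Function.update x m v))| ≤ M₀ * Pw / D := by
    rw [abs_mul, abs_of_nonneg (mul_nonneg hc0 hlogR.le)]
    have hdiff2 : ℓ - (1 - s) ≤ Real.log 2 / Real.log R := by linarith only [hℓhi]
    calc c * Real.log R * |(∫ v in (0 : ℝ)..ℓ, G (Function.update x m v)) -
          ∫ v in (0 : ℝ)..(1 - s), G (Function.update x m v)|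
        ≤ c * Real.log R * (M₀ * (ℓ - (1 - s))) :=
          mul_le_mul_of_nonneg_left hIdiff (mul_nonneg hc0 hlogR.le)
      _ ≤ φW * Real.log R * (M₀ * (Real.log 2 / Real.log R)) := by
          refine mul_le_mul (mul_le_mul_of_nonneg_right hcle hlogR.le) ?_
            (mul_nonneg hM₀pos.le (by linarith only [hℓlo])) (mul_nonneg hφW0.le hlogR.le)
          exact mul_le_mul_of_nonneg_left hdiff2 hM₀pos.le
      _ = φW * M₀ * Real.log 2 := by field_simp
      _ ≤ φW * M₀ * 1 := mul_le_mul_of_nonneg_left hlog2 (mul_nonneg hφW0.le hM₀0)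
      _ = M₀ * (φW * D) / D := by field_simp
      _ ≤ M₀ * (φW * Real.log R) / D :=
          div_le_div_of_nonneg_right (mul_le_mul_of_nonneg_left
            (mul_le_mul_of_nonneg_left hDlog hφW0.le) hM₀0) hDpos.le
      _ = M₀ * Pw / D := by rw [hPwdef]
  calc |MaynardSieve.ym W B y m r - MaynardSieve.kappa r * MaynardSieve.Mterm B y m r +
          (MaynardSieve.kappa r * MaynardSieve.Mterm B y m r - MaynardSieve.Mterm B y m r) +
          (GGPY.moebiusSqGSumWeighted (gammaInd P) Ft z -
            c * (Real.log R * ∫ v in (0 : ℝ)..ℓ, G (Function.update x m v))) +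
          c * Real.log R * ((∫ v in (0 : ℝ)..ℓ, G (Function.update x m v)) -
            ∫ v in (0 : ℝ)..(1 - s), G (Function.update x m v))|
      ≤ |MaynardSieve.ym W B y m r - MaynardSieve.kappa r * MaynardSieve.Mterm B y m r| +
          |MaynardSieve.kappa r * MaynardSieve.Mterm B y m r - MaynardSieve.Mterm B y m r| +
          |GGPY.moebiusSqGSumWeighted (gammaInd P) Ft z -
            c * (Real.log R * ∫ v in (0 : ℝ)..ℓ, G (Function.update x m v))| +
          |c * Real.log R * ((∫ v in (0 : ℝ)..ℓ, G (Function.update x m v)) -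
            ∫ v in (0 : ℝ)..(1 - s), G (Function.update x m v))| := abs_add_four_le _ _ _ _
    _ ≤ 4 * (k : ℝ) * bL * 3 ^ k * M₀ * Pw / D + 2 * (k : ℝ) * M₀ * bL * Pw / D +
          |C₄| * (M₀ + 2 * M₁) * Pw / D + M₀ * Pw / D :=
        add_le_add (add_le_add (add_le_add hE53 hEκ) hT3) hT4
    _ = Ctot * Pw / D := by rw [hCtotdef]; ring

end Literature.NumberTheory.Sieve
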